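import Summits.SmoothPoincare4.SmoothPoincare4.Theses.ConvexBisection
import Literature.Geometry.Symplectic.SteinBoundaryContactProofs
import Literature.Geometry.Symplectic.JConvexMaximumPrinciple
import Literature.AlgebraicTopology.SingularHomology.LocalHomologyVanishing
import Literature.Topology.FourManifolds.BoundaryGluingRelHomology
import Literature.Topology.FourManifolds.RelFundamentalClassOfOrientation
import Literature.Topology.FourManifolds.BordismFourProjectivePlane
import Literature.AlgebraicTopology.SingularHomology.RelFundamentalClassModTwo
import Literature.AlgebraicTopology.SingularHomology.UniversalCoefficientsField
import Literature.Geometry.Symplectic.SteinOrientation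
import Literature.Topology.FourManifolds.HomotopySpheresSignatureKilling
import Literature.AlgebraicTopology.SingularHomology.ExcisionMayerVietorisProofs
import Literature.AlgebraicTopology.SingularHomology.SphereHomology
import Literature.AlgebraicTopology.SingularHomology.ClopenAdditivity
import Literature.Topology.FourManifolds.HomotopyS4CompactProofs
import Summits.SmoothPoincare4.SmoothPoincare4.Theorems.ContractibleTwistedDoubleStandard.Negative.DoubleBisection
import Literature.Topology.FourManifolds.GluingProofs

/-!
# Disproof of `AcyclicBisectionExists` — findings (cdisprove gen 2 + gen 3)

Work file of the standing disprover on crux `ConvexBisection.AcyclicBisectionExists`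
(item `stmt-SmoothPoincare4-10508`).  Everything below is PROVED (rc 0, no `sorry`, axioms
`propext / Classical.choice / Quot.sound`); prose only in docstrings.  Index:

* §0 `Witness`, `HasAcyclicSteinBisection`, `acyclicBisectionExists_iff` — the ∃-body of the
  crux as a structure (data + the six point-set/contact conditions) and a predicate on `M`;
  `Witness.Acyclic` (the homological conjunct), one-sided versions `AcyclicLeft/Right`.
* §1 junk models: `steinStructureOfIsEmpty`, `hasAcyclicSteinBisection_of_isEmpty` (the ∃-body
  holds vacuously over the empty 4-manifold: content starts at `Nonempty M`).
* §2 structure of witnesses: `Witness.compactSpace` (any witness forces `M` compact), T2 /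
  second-countability of the halves, `seam = eᵢ '' ∂Wᵢ`, interiors never meet the other half,
  `isEmpty_of_seam_eq_empty` and `seam_nonempty` (NO connectedness needed: maximum principle),
  halves/boundaries nonempty, every component of a half reaches the seam.
* §3 load-bearing hypothesis: `acyclicBisectionExists_false_without_homotopyEquiv` (drop
  `M ≃ₕ S⁴`: false at `M = ℝ⁴`).
* §4 refuted strengthening: `not_acyclicBisectionExistsAllDegrees` (the guard `0 < k` is needed:
  at `M = S⁴`, `H₀(W; ℚ) = 0` forces `W = ∅`).
* §5 `Witness.gluingData` — EVERY WITNESS IS A TREE `BoundaryGluingData` (`NullCobordism` halves,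
  boundary bijection `seamEquiv`, `e₂ ∘ φ = e₁`): gluing uniqueness, flat seam charts and the
  relative-homology isomorphisms of `Literature.Topology.FourManifolds` apply verbatim.
* §6 homological bookkeeping: `isIso_relMap₂` (`Hₖ(W₂, ∂W₂; G) ≅ Hₖ(M, e₁W₁; G)`),
  `exists_isRelFundamentalClass_rat₂` / `exists_lefschetz₂` (the Stein half is ℚ-oriented;
  Lefschetz duality `Hᵖ(W₂; ℚ) ≅ H_q(W₂, ∂W₂; ℚ)`), `isZero_relHomology₂`,
  `isZero_homology_of_acyclic` (**any `M` carrying an acyclic witness has `H₁ = H₂ = H₃ = 0`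
  over ℚ**), `isZero_homology_bd₂/bd₁` (the seam is a ℚ-homology sphere in degrees 1, 2 — for ANY
  `M`), and the `swap` symmetry `W₁ ↔ W₂`.
* §8 (before §7 in the file) HOMOLOGY CONTROL ON ONE HALF SUFFICES:
  `acyclicRight_of_acyclicLeft_of_homotopyEquiv` — over `M ≃ₕ S⁴` with both halves connected,
  `W₁` ℚ-acyclic ⇒ `W₂` ℚ-acyclic (gen-1 near-miss `isZero_homology_right_of_left`, CLOSED).
* §9 CONNECTEDNESS BOOKKEEPING: `Witness.connectedSpace_bd₁` (`W₁` connected and ℚ-acyclic ⇒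
  `∂W₁` connected, via `H₀` and clopen additivity), `isConnected_seam`, `seamHomeomorph`
  (`∂W₁ ≃ₜ ∂W₂`), `connectedSpace₂` (then `W₂` is connected, maximum principle), and the final
  one-sided form `acyclicRight_of_acyclicLeft_of_homotopyEquiv'` (only `[ConnectedSpace W₁]`).
* §10 `finrank_homology_bd₂_three` (the seam is a full ℚHS³: `dim H₃(∂W₂; ℚ) = 1`),
  `acyclic_of_seam` / `acyclic_iff_seam_of_homotopyEquiv` — the CONVERSE bookkeeping: over
  `M ≃ₕ S⁴` with connected halves, ℚ-acyclic ⇔ seam a ℚHS in degrees 1, 2 (the crux's informal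
  "(⇔ seam a connected ℚHS³)", machine-checked in both directions).
* §10b `connectedSpace₁_of_acyclic` / `connectedSpace₂_of_acyclic` (over a path-connected `M`
  BOTH halves of an acyclic witness are automatically connected), `seam_connected_QHS_of_homotopyEquiv`
  (over `M ≃ₕ S⁴`: seam connected, `H₁ = H₂ = 0`, `dim H₃ = 1` — NO extra hypothesis),
  `acyclic_iff_connected_and_seam`.
* §11 TIGHTNESS and the kill criterion, formally: `hasAcyclicSteinBisection_sphere` (the ∃-body
  HOLDS at the round `S⁴`: hemisphere bisection, both halves the standard Stein ball — via the
  sibling crux's landed `crux_hypotheses_at_sphere`), `Witness.transport` (diffeomorphism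
  invariance), `acyclicBisectionExists_of_spc4 : SmoothPoincare4 → AcyclicBisectionExists`,
  `not_spc4_of_not_acyclicBisectionExists`, `exotic_of_not_acyclicBisectionExists` (a kill of this
  crux is literally an exotic 4-sphere).
* §7 `not_hasAcyclicSteinBisection_complexProjectivePlane`,
  `not_acyclicBisectionExistsForSimplyConnectedClosed` — the hypothesis `M ≃ₕ S⁴` cannot be
  weakened to "closed simply connected": `ℂℙ²` has no ℚ-acyclic Stein bisection (gen-1 near-miss
  `acyclicBisectionExists_false_for_closed`, CLOSED).  So the homotopy-sphere hypothesis is used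
  exactly through `b₁ = b₂ = b₃ = 0`.

* §12 (gen 3) `Witness.finrank_homology_four_of_acyclic`, `rationalHomologySphere_of_acyclic`:
  an acyclic witness over a path-connected `M` forces `dim H₄(M; ℚ) = 1` — with §6 the ∃-body
  pins `M` to be a ℚ-homology 4-SPHERE in every degree (closed connected non-orientable `M`, e.g.
  `ℝℙ⁴`, excluded although rationally acyclic in degrees 1–3).  Landed: `Negative/TopDegree.lean`.
* §13 (gen 3) `Witness.ofIsDouble`, `hasAcyclicSteinBisection_of_isDouble`,
  `exists_double_hasAcyclicSteinBisection`: the ∃-body HOLDS on every double `D(W)` of a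
  ℚ-acyclic compact Stein domain (the `ψ = id` sector of the existence crux is free; on paper
  `D(B_{p,q})` shows the ∃-body does not detect homotopy spheres).  Landed: `Negative/Doubles.lean`.
* §14 (gen 3) TARGETS: the registered skeleton `braided-branch-locus` — `stub_hurwitzTransitive`
  decided TRUE for all `m ≤ 7, n ≤ 7` (+ `m ≤ 4, n ≤ 9`; exact stabiliser-image method with single-orbit
  certification, kit j008817/j008818 pending for larger `n`), proved on paper for all `(m, n)` modulo Kluitmann, and reduced
  formally to the sorted case (`Targets.hurwitzTransitivity_of_sorted`, sorry-free); no stub of any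
  line refuted.
* §15 (gen 3) `map_mfderiv_incl_boundaryPlaneField`, `steinBisection_of_twistedGlue`, `hasAcyclicSteinBisection_of_twistedGlue`,
  `exists_twistedGlue_hasAcyclicSteinBisection`: every CONTACT TWISTED DOUBLE `W₁ ∪_ψ W₂` (ψ a
  diffeomorphism `∂W₁ ≅ ∂W₂` carrying the `J₁`-induced plane field to the `J₂`-induced one, both
  halves ℚ-acyclic compact Stein) satisfies the ∃-body — the constructive half of the thesis'
  dictionary; cork twists by contactomorphisms included.  Landed: `Negative/TwistedDoubles.lean`.
* §10b/§11 landed as `Negative/Sphere.lean` (p72150).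

WHY IT RESISTS (summary for provers/planners): the statement is implied by SPC4 (hemisphere
bisection of the round `S⁴` by two copies of the tree's `steinStructureClosedBall`), so `¬S`
exhibits an exotic `S⁴`; no formalisation defect was found by four refuter passes
(SteinStructure is honest — `boundary_eq` + maximum principle exclude closed/one-piece junk;
`IsSmoothEmbedding` is Mathlib's chart-immersion + embedding, satisfiable at boundary points, cf.
`ModelWithCorners.isImmersion`; `contactPlane` is read in the preferred boundary chart, consistent
with `mfderiv`; homology is Mathlib's).  Mathematically the crux is Akbulut–Matveyev (IMRN 1998)
§6 Question 1 WITH homology control: AM Thm 3/Cor 1 give ℚ-acyclic (even contractible /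
ℤ-acyclic) Stein halves with only HOMOTOPIC contact structures on the seam; Baykur
(arXiv:math/0601396) Thm 5.1 / Breen (arXiv:2311.16058) Thm 1.6 give matching contact seams but
destroy acyclicity (stabilisations).  By §6–§8 the homological side of the crux is completely
rigid: the seam is a ℚHS³, `M` must be a ℚ-homology sphere in degrees 1–3, and one half's
acyclicity determines the other's — all the difficulty sits in the CONTACT-MATCHING conjunct
(making the two induced tight structures on the ℚHS³ seam coincide while keeping a half acyclic),
for which no obstruction is computable and no simplification technology exists in dimension 5
(Honda–Huang) — exactly gen-1's diagnosis, now with the homology bookkeeping machine-checked.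
-/

noncomputable section

set_option linter.dupNamespace false

open scoped Manifold ContDiff Topology ContinuousMap
open Set Function CategoryTheory CategoryTheory.Limits
open Literature.Geometry.Symplectic Literature.AlgebraicTopology.SingularHomology

namespace Summit.SmoothPoincare4.SmoothPoincare4.Cruxes.AcyclicBisectionExists.Disproof

open Summit.SmoothPoincare4.SmoothPoincare4.Theses.ConvexBisection

/-- Local notation: the model space `ℝ⁴`. -/
local notation "𝔼4" => EuclideanSpace ℝ (Fin 4)
/-- Local notation: the round 4-sphere. -/
local notation "𝕊⁴" => (Metric.sphere (0 : EuclideanSpace ℝ (Fin 5)) 1)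
/-- Local notation: the model space `ℝ³`. -/
local notation "𝔼3" => EuclideanSpace ℝ (Fin 3)

/-! ## §0 The ∃-body of the crux as a structure -/

/-- **A witness of the crux over `M`**: the data `(W₁, W₂, J₁, J₂, e₁, e₂)` of a Stein bisection of
`M` along a common contact seam, i.e. the ∃-body of `AcyclicBisectionExists` minus the homological
conjunct (which is `Witness.Acyclic`). [folklore] -/
structure Witness (M : Type) [TopologicalSpace M] [ChartedSpace 𝔼4 M] where
  /-- first half -/
  W₁ : Type
  [top₁ : TopologicalSpace W₁]
  [chart₁ : ChartedSpace (EuclideanHalfSpace 4) W₁]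
  [mfd₁ : IsManifold (𝓡∂ 4) ∞ W₁]
  [cpt₁ : CompactSpace W₁]
  /-- second half -/
  W₂ : Type
  [top₂ : TopologicalSpace W₂]
  [chart₂ : ChartedSpace (EuclideanHalfSpace 4) W₂]
  [mfd₂ : IsManifold (𝓡∂ 4) ∞ W₂]
  [cpt₂ : CompactSpace W₂]
  /-- the Stein structures -/
  J₁ : SteinStructure W₁
  J₂ : SteinStructure W₂
  /-- the embeddings -/
  e₁ : W₁ → M
  e₂ : W₂ → M
  emb₁ : Manifold.IsSmoothEmbedding (𝓡∂ 4) (𝓡 4) ∞ e₁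
  emb₂ : Manifold.IsSmoothEmbedding (𝓡∂ 4) (𝓡 4) ∞ e₂
  cover : range e₁ ∪ range e₂ = univ
  inter₁ : range e₁ ∩ range e₂ = e₁ '' (𝓡∂ 4).boundary W₁
  inter₂ : range e₁ ∩ range e₂ = e₂ '' (𝓡∂ 4).boundary W₂
  contact : ∀ w₁ w₂, e₁ w₁ = e₂ w₂ →
    Submodule.map (mfderiv (𝓡∂ 4) (𝓡 4) e₁ w₁).toLinearMap (contactPlane J₁.J w₁) =
      Submodule.map (mfderiv (𝓡∂ 4) (𝓡 4) e₂ w₂).toLinearMap (contactPlane J₂.J w₂)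

attribute [instance] Witness.top₁ Witness.chart₁ Witness.mfd₁ Witness.cpt₁
  Witness.top₂ Witness.chart₂ Witness.mfd₂ Witness.cpt₂

namespace Witness

variable {M : Type} [TopologicalSpace M] [ChartedSpace 𝔼4 M]

/-- The homological conjunct of the crux: both halves are ℚ-acyclic in positive degrees. [folklore] -/
def Acyclic (B : Witness M) : Prop :=
  ∀ k, 0 < k → IsZero (singularHomology ℚ ℚ B.W₁ k) ∧ IsZero (singularHomology ℚ ℚ B.W₂ k)

/-- One-sided acyclicity: only the FIRST half is ℚ-acyclic in positive degrees. [folklore] -/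
def AcyclicLeft (B : Witness M) : Prop :=
  ∀ k, 0 < k → IsZero (singularHomology ℚ ℚ B.W₁ k)

/-- One-sided acyclicity: only the SECOND half is ℚ-acyclic in positive degrees. [folklore] -/
def AcyclicRight (B : Witness M) : Prop :=
  ∀ k, 0 < k → IsZero (singularHomology ℚ ℚ B.W₂ k)

/-- The left half of an acyclic witness is acyclic. [folklore] -/
theorem Acyclic.left {B : Witness M} (hB : B.Acyclic) : B.AcyclicLeft := fun k hk => (hB k hk).1
/-- The right half of an acyclic witness is acyclic. [folklore] -/
theorem Acyclic.right {B : Witness M} (hB : B.Acyclic) : B.AcyclicRight := fun k hk => (hB k hk).2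
/-- Acyclicity is the conjunction of the two one-sided conditions. [folklore] -/
theorem acyclic_iff (B : Witness M) : B.Acyclic ↔ B.AcyclicLeft ∧ B.AcyclicRight :=
  ⟨fun h => ⟨h.left, h.right⟩, fun h k hk => ⟨h.1 k hk, h.2 k hk⟩⟩

/-- The strengthened conjunct WITHOUT the degree guard `0 < k` (see §4). [folklore] -/
def AcyclicAllDegrees (B : Witness M) : Prop :=
  ∀ k, IsZero (singularHomology ℚ ℚ B.W₁ k) ∧ IsZero (singularHomology ℚ ℚ B.W₂ k)

/-- The seam `e₁(W₁) ∩ e₂(W₂)`. [folklore] -/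
def seam (B : Witness M) : Set M := range B.e₁ ∩ range B.e₂

end Witness

/-- **The ∃-body of the crux as a predicate on `M`.** [folklore] -/
def HasAcyclicSteinBisection (M : Type) [TopologicalSpace M] [ChartedSpace 𝔼4 M] : Prop :=
  ∃ B : Witness M, B.Acyclic

/-- The crux, unfolded: `AcyclicBisectionExists ↔ ∀ M ≃ₕ S⁴, HasAcyclicSteinBisection M`.
[folklore] -/
theorem acyclicBisectionExists_iff :
    AcyclicBisectionExists ↔
      ∀ (M : Type) [TopologicalSpace M] [T2Space M] [SecondCountableTopology M]
        [ChartedSpace 𝔼4 M] [IsManifold (𝓡 4) ∞ M], M ≃ₕ 𝕊⁴ → HasAcyclicSteinBisection M := by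
  constructor
  · intro h M _ _ _ _ _ f
    obtain ⟨W₁, _, _, _, _, W₂, _, _, _, _, J₁, J₂, e₁, e₂, h1, h2, h3, h4, h5, h6, h7⟩ := h M f
    exact ⟨⟨W₁, W₂, J₁, J₂, e₁, e₂, h1, h2, h3, h4, h5, h6⟩, h7⟩
  · intro h M _ _ _ _ _ f
    obtain ⟨B, hB⟩ := h M f
    exact ⟨B.W₁, inferInstance, inferInstance, inferInstance, inferInstance, B.W₂, inferInstance,
      inferInstance, inferInstance, inferInstance, B.J₁, B.J₂, B.e₁, B.e₂, B.emb₁, B.emb₂, B.cover,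
      B.inter₁, B.inter₂, B.contact, hB⟩

/-! ## §1 Junk models -/

/-- The empty type is vacuously a Stein domain (all fields quantify over points). [folklore] -/
def steinStructureOfIsEmpty (W : Type*) [TopologicalSpace W] [ChartedSpace (EuclideanHalfSpace 4) W]
    [IsManifold (𝓡∂ 4) ∞ W] [CompactSpace W] [IsEmpty W] : SteinStructure W where
  J := fun x => isEmptyElim x
  φ := fun x => isEmptyElim x
  J_sq := fun x => isEmptyElim x
  J_smooth := fun _ _ x => isEmptyElim x
  integrable := fun _ _ _ _ x => isEmptyElim x
  φ_smooth := fun x => isEmptyElim x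
  convex := fun x => isEmptyElim x
  boundary_eq := fun x => isEmptyElim x
  regular := fun x => isEmptyElim x

/-- The empty charted space over the half-space (Mathlib `ChartedSpace.empty`; the `C^∞`
structure is Mathlib's instance `IsManifold.empty`). [folklore] -/
instance : ChartedSpace (EuclideanHalfSpace 4) Empty := ChartedSpace.empty _ _

/-- **Junk inhabitant.** Over an EMPTY `M` the ∃-body holds (both halves empty): the content of
the crux starts at `Nonempty M` (automatic for `M ≃ₕ S⁴`). [folklore] -/
theorem hasAcyclicSteinBisection_of_isEmpty (M : Type) [TopologicalSpace M] [ChartedSpace 𝔼4 M]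
    [IsManifold (𝓡 4) ∞ M] [IsEmpty M] : HasAcyclicSteinBisection M := by
  refine ⟨⟨Empty, Empty, steinStructureOfIsEmpty Empty, steinStructureOfIsEmpty Empty,
    Empty.elim, Empty.elim, ?_, ?_, ?_, ?_, ?_, ?_⟩, ?_⟩
  · exact ⟨⟨ℝ, inferInstance, inferInstance, fun x => isEmptyElim x⟩, .of_subsingleton _⟩
  · exact ⟨⟨ℝ, inferInstance, inferInstance, fun x => isEmptyElim x⟩, .of_subsingleton _⟩
  · exact Subsingleton.elim _ _
  · ext x; exact isEmptyElim x
  · ext x; exact isEmptyElim x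
  · intro w; exact w.elim
  · intro k hk
    exact ⟨isZero_singularHomology_of_subsingleton (X := Empty) ℚ ℚ (Nat.pos_iff_ne_zero.1 hk),
      isZero_singularHomology_of_subsingleton (X := Empty) ℚ ℚ (Nat.pos_iff_ne_zero.1 hk)⟩

/-! ## §2 Structure of witnesses -/

namespace Witness

variable {M : Type} [TopologicalSpace M] [ChartedSpace 𝔼4 M] (B : Witness M)

/-- The first embedding is continuous. [folklore] -/
theorem continuous_e₁ : Continuous B.e₁ := B.emb₁.isEmbedding.continuous
/-- The second embedding is continuous. [folklore] -/
theorem continuous_e₂ : Continuous B.e₂ := B.emb₂.isEmbedding.continuous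
/-- The first embedding is injective. [folklore] -/
theorem injective_e₁ : Injective B.e₁ := B.emb₁.isEmbedding.injective
/-- The second embedding is injective. [folklore] -/
theorem injective_e₂ : Injective B.e₂ := B.emb₂.isEmbedding.injective
/-- The image of the first half is compact. [folklore] -/
theorem isCompact_range_e₁ : IsCompact (range B.e₁) := isCompact_range B.continuous_e₁
/-- The image of the second half is compact. [folklore] -/
theorem isCompact_range_e₂ : IsCompact (range B.e₂) := isCompact_range B.continuous_e₂

/-- **Any witness forces `M` to be compact** (`M` is the union of two compact images). [folklore] -/
theorem compactSpace (B : Witness M) : CompactSpace M :=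
  ⟨by rw [← B.cover]; exact B.isCompact_range_e₁.union B.isCompact_range_e₂⟩

/-- The halves inherit the Hausdorff property from `M` (they embed). [folklore] -/
theorem t2Space₁ [T2Space M] : T2Space B.W₁ := B.emb₁.isEmbedding.t2Space

/-- The second half is Hausdorff when `M` is. [folklore] -/
theorem t2Space₂ [T2Space M] : T2Space B.W₂ := B.emb₂.isEmbedding.t2Space

/-- The halves inherit second countability from `M` (they embed). [folklore] -/
theorem secondCountableTopology₁ [SecondCountableTopology M] : SecondCountableTopology B.W₁ :=
  B.emb₁.isEmbedding.secondCountableTopology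

/-- The second half is second countable when `M` is. [folklore] -/
theorem secondCountableTopology₂ [SecondCountableTopology M] : SecondCountableTopology B.W₂ :=
  B.emb₂.isEmbedding.secondCountableTopology

/-- The seam is the image of `∂W₁`. [folklore] -/
theorem seam_eq_image₁ : B.seam = B.e₁ '' (𝓡∂ 4).boundary B.W₁ := B.inter₁
/-- The seam is the image of `∂W₂`. [folklore] -/
theorem seam_eq_image₂ : B.seam = B.e₂ '' (𝓡∂ 4).boundary B.W₂ := B.inter₂
/-- The seam lies in the first half. [folklore] -/
theorem seam_subset_range_e₁ : B.seam ⊆ range B.e₁ := inter_subset_left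
/-- The seam lies in the second half. [folklore] -/
theorem seam_subset_range_e₂ : B.seam ⊆ range B.e₂ := inter_subset_right
/-- The seam is compact. [folklore] -/
theorem isCompact_seam : IsCompact B.seam := by
  rw [seam_eq_image₁]
  exact ((ModelWithCorners.isClosed_boundary (I := 𝓡∂ 4) (M := B.W₁) (n := ∞) (by simp)).isCompact).image
    B.continuous_e₁

/-- A point of `W₁` mapped into `e₂(W₂)` is a boundary point of `W₁`. [folklore] -/
theorem mem_boundary₁_of_mem_range (w : B.W₁) (h : B.e₁ w ∈ range B.e₂) :
    w ∈ (𝓡∂ 4).boundary B.W₁ := by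
  have : B.e₁ w ∈ B.e₁ '' (𝓡∂ 4).boundary B.W₁ := by
    rw [← B.inter₁]; exact ⟨mem_range_self w, h⟩
  obtain ⟨w', hw', he⟩ := this
  exact B.injective_e₁ he ▸ hw'

/-- A point of `W₂` mapped into `e₁(W₁)` is a boundary point of `W₂`. [folklore] -/
theorem mem_boundary₂_of_mem_range (w : B.W₂) (h : B.e₂ w ∈ range B.e₁) :
    w ∈ (𝓡∂ 4).boundary B.W₂ := by
  have : B.e₂ w ∈ B.e₂ '' (𝓡∂ 4).boundary B.W₂ := by
    rw [← B.inter₂]; exact ⟨h, mem_range_self w⟩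
  obtain ⟨w', hw', he⟩ := this
  exact B.injective_e₂ he ▸ hw'

/-- **Interior points are never seam points**: `e₁ (Int W₁) ∩ e₂ (W₂) = ∅`, i.e. the two
halves overlap exactly along the seam (the intended `Σ = W₁ ∪_Γ W̄₂` shape; no thick overlaps).
[folklore] -/
theorem image_interior₁_inter_range_e₂ :
    B.e₁ '' (𝓡∂ 4).interior B.W₁ ∩ range B.e₂ = ∅ := by
  ext p
  simp only [mem_inter_iff, mem_image, mem_empty_iff_false, iff_false, not_and]
  rintro ⟨w, hw, rfl⟩ hp
  have hb := B.mem_boundary₁_of_mem_range w hp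
  rw [← ModelWithCorners.compl_interior] at hb
  exact hb hw

/-- The seam points seen from `W₁`, resp. `W₂`: `e₁ w₁ = e₂ w₂` forces both to be boundary
points (so the contact condition of the crux only ever speaks about boundary points, where
`contactPlane` is meaningful). [folklore] -/
theorem mem_boundary_of_eq {w₁ : B.W₁} {w₂ : B.W₂} (h : B.e₁ w₁ = B.e₂ w₂) :
    w₁ ∈ (𝓡∂ 4).boundary B.W₁ ∧ w₂ ∈ (𝓡∂ 4).boundary B.W₂ :=
  ⟨B.mem_boundary₁_of_mem_range w₁ ⟨w₂, h.symm⟩, B.mem_boundary₂_of_mem_range w₂ ⟨w₁, h⟩⟩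

/-- **Empty seam forces empty `M`.**  If the seam is empty then `∂W₁ = ∅ = ∂W₂`
(`seam = eᵢ '' ∂Wᵢ`), so by the tree's PROVED `J`-convex maximum principle
(`SteinStructure.exists_isBoundaryPoint`: a nonempty compact Stein domain has a boundary point)
both halves are empty, hence so is `M = e₁ W₁ ∪ e₂ W₂`.  No connectedness or separation
hypothesis on `M` is needed. [folklore] -/
theorem isEmpty_of_seam_eq_empty (h : B.seam = ∅) : IsEmpty M := by
  have h1 : IsEmpty B.W₁ := by
    by_contra hne
    rw [not_isEmpty_iff] at hne
    obtain ⟨x, hx⟩ := B.J₁.exists_isBoundaryPoint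
    have : B.e₁ x ∈ B.seam := by rw [seam_eq_image₁]; exact mem_image_of_mem _ hx
    rw [h] at this
    exact this
  have h2 : IsEmpty B.W₂ := by
    by_contra hne
    rw [not_isEmpty_iff] at hne
    obtain ⟨x, hx⟩ := B.J₂.exists_isBoundaryPoint
    have : B.e₂ x ∈ B.seam := by rw [seam_eq_image₂]; exact mem_image_of_mem _ hx
    rw [h] at this
    exact this
  refine ⟨fun p => ?_⟩
  have hp : p ∈ range B.e₁ ∪ range B.e₂ := by rw [B.cover]; exact mem_univ p
  rcases hp with ⟨w, -⟩ | ⟨w, -⟩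
  · exact h1.false w
  · exact h2.false w

/-- **Over a nonempty `M` the seam of every witness is nonempty** (sharper than the informal
"by connectedness": only the maximum principle is used). [folklore] -/
theorem seam_nonempty [Nonempty M] : B.seam.Nonempty := by
  by_contra h
  rw [not_nonempty_iff_eq_empty] at h
  exact (B.isEmpty_of_seam_eq_empty h).false (Classical.arbitrary M)

/-- Over a nonempty `M` both halves of every witness are nonempty. [folklore] -/
theorem halves_nonempty [Nonempty M] : Nonempty B.W₁ ∧ Nonempty B.W₂ := by
  obtain ⟨p, ⟨w₁, -⟩, ⟨w₂, -⟩⟩ := B.seam_nonempty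
  exact ⟨⟨w₁⟩, ⟨w₂⟩⟩

/-- Over a nonempty `M` both halves have nonempty boundary: one-piece "bisections"
(`W₂ = ∅`, `W₁ = M` recharted, closed Stein pieces) are excluded by the statement itself.
[folklore] -/
theorem boundaries_nonempty [Nonempty M] :
    ((𝓡∂ 4).boundary B.W₁).Nonempty ∧ ((𝓡∂ 4).boundary B.W₂).Nonempty := by
  obtain ⟨p, hp⟩ := B.seam_nonempty
  have h1 := hp; have h2 := hp
  rw [seam_eq_image₁] at h1
  rw [seam_eq_image₂] at h2
  obtain ⟨w₁, hw₁, -⟩ := h1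
  obtain ⟨w₂, hw₂, -⟩ := h2
  exact ⟨⟨w₁, hw₁⟩, ⟨w₂, hw₂⟩⟩

/-- **Every connected component of either half reaches the seam** (tree:
`SteinStructure.exists_isBoundaryPoint_mem_connectedComponent`, the `J`-convex maximum principle
on a compact open component).  Hence `H₀(Wᵢ, ∂Wᵢ) = 0` in any witness: the halves have no closed
components, and the homological bookkeeping of the route (MV in the homology sphere) sees every
component of `Wᵢ` through the seam. [folklore] -/
theorem connectedComponent_meets_seam₁ [T2Space M] (w : B.W₁) :
    ∃ w' ∈ connectedComponent w, B.e₁ w' ∈ B.seam := by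
  haveI := B.t2Space₁
  obtain ⟨w', hw', hb⟩ := B.J₁.exists_isBoundaryPoint_mem_connectedComponent w
  exact ⟨w', hw', by rw [seam_eq_image₁]; exact mem_image_of_mem _ hb⟩

/-- Every connected component of `W₂` reaches the seam (maximum principle). [folklore] -/
theorem connectedComponent_meets_seam₂ [T2Space M] (w : B.W₂) :
    ∃ w' ∈ connectedComponent w, B.e₂ w' ∈ B.seam := by
  haveI := B.t2Space₂
  obtain ⟨w', hw', hb⟩ := B.J₂.exists_isBoundaryPoint_mem_connectedComponent w
  exact ⟨w', hw', by rw [seam_eq_image₂]; exact mem_image_of_mem _ hb⟩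

end Witness

/-! ## §3 Load-bearing hypothesis: the homotopy-sphere hypothesis cannot be dropped -/

/-- The crux with the hypothesis `M ≃ₕ S⁴` DROPPED: every (Hausdorff, second countable) smooth
4-manifold has a ℚ-acyclic Stein bisection along a common contact seam. [folklore] -/
def AcyclicBisectionExistsWithoutHomotopyEquiv : Prop :=
  ∀ (M : Type) [TopologicalSpace M] [T2Space M] [SecondCountableTopology M]
    [ChartedSpace 𝔼4 M] [IsManifold (𝓡 4) ∞ M], HasAcyclicSteinBisection M

/-- **Any proof must use `M ≃ₕ S⁴` (at least its consequence `CompactSpace M`)**: the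
hypothesis-free version is false at `M = ℝ⁴`, which is not compact, while every witness forces
compactness (`Witness.compactSpace`).  (The finer near-miss — false also for CLOSED `M`, where
the homological content of `M ≃ₕ S⁴` is what is used — is §5.) [folklore] -/
theorem acyclicBisectionExists_false_without_homotopyEquiv :
    ¬ AcyclicBisectionExistsWithoutHomotopyEquiv := by
  intro h
  obtain ⟨B, -⟩ := h 𝔼4
  exact (not_compactSpace_iff.2 (inferInstance : NoncompactSpace 𝔼4)) B.compactSpace

/-! ## §4 Refuted strengthening: the degree guard `0 < k` is not removable -/

/-- `H₀(X; ℚ) = 0` forces `X = ∅` (the augmentation `ε : H₀(X; ℚ) → ℚ` is onto for nonempty `X`,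
tree `singularHomology.epi_ε_of_nonempty`). [folklore] -/
theorem isEmpty_of_isZero_singularHomology_zero {X : Type} [TopologicalSpace X]
    (h : IsZero (singularHomology ℚ ℚ X 0)) : IsEmpty X := by
  by_contra hne
  rw [not_isEmpty_iff] at hne
  haveI := singularHomology.epi_ε_of_nonempty (R := ℚ) (M := ℚ) (X := X)
  have hz : IsZero (ModuleCat.of ℚ (ULift.{0} ℚ)) := h.of_epi (singularHomology.ε ℚ ℚ X)
  have key := congrArg (fun f : ModuleCat.of ℚ (ULift.{0} ℚ) ⟶ ModuleCat.of ℚ (ULift.{0} ℚ) =>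
    (f.hom (ULift.up 1)).down) (hz.eq_of_src (𝟙 _) 0)
  simp at key

/-- The crux with the degree guard dropped: both halves ℚ-acyclic in ALL degrees, including
`k = 0`. [folklore] -/
def AcyclicBisectionExistsAllDegrees : Prop :=
  ∀ (M : Type) [TopologicalSpace M] [T2Space M] [SecondCountableTopology M]
    [ChartedSpace 𝔼4 M] [IsManifold (𝓡 4) ∞ M], M ≃ₕ 𝕊⁴ → ∃ B : Witness M, B.AcyclicAllDegrees

/-- **The guard `0 < k` is load-bearing**: with `k = 0` included the statement is false already
at the round `S⁴` — `H₀(W₁; ℚ) = 0` forces `W₁ = ∅`, then the seam is empty, so `M = ∅`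
(`Witness.isEmpty_of_seam_eq_empty`), but `S⁴ ≠ ∅`. [folklore] -/
theorem not_acyclicBisectionExistsAllDegrees : ¬ AcyclicBisectionExistsAllDegrees := by
  intro h
  obtain ⟨B, hB⟩ := h 𝕊⁴ (ContinuousMap.HomotopyEquiv.refl _)
  have h1 : IsEmpty B.W₁ := isEmpty_of_isZero_singularHomology_zero (hB 0).1
  have hs : B.seam = ∅ := by
    rw [B.seam_eq_image₁]; exact image_eq_empty.2 (eq_empty_of_isEmpty _)
  haveI := B.isEmpty_of_seam_eq_empty hs
  have p : 𝕊⁴ := ⟨EuclideanSpace.single 0 1, by simp⟩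
  exact IsEmpty.false p

/-! ## §5 Every witness is a boundary gluing (tree `BoundaryGluingData`) -/

namespace Witness

open Literature.Topology.FourManifolds

variable {M : Type} [TopologicalSpace M] [ChartedSpace 𝔼4 M] (B : Witness M)

/-- The boundary `∂W₁` of the first half, as a type. [folklore] -/
abbrev Bd₁ (B : Witness M) : Type := ↥((𝓡∂ 4).boundary B.W₁)

/-- The boundary `∂W₂` of the second half, as a type. [folklore] -/
abbrev Bd₂ (B : Witness M) : Type := ↥((𝓡∂ 4).boundary B.W₂)

/-! Bridging instances: the tree's boundary/gluing library is written at dimension `n + 1`;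
instance search does not see the literal `4` as `3 + 1`, so we re-export the structure of the
halves at `3 + 1` and register the boundary manifolds (`BoundaryManifold.chartedSpace/isManifold`,
Lee Thm 5.11) explicitly. -/

/-- The atlas of `W₁`, re-keyed at `3 + 1`. [folklore] -/
instance chart₁' : ChartedSpace (EuclideanHalfSpace (3 + 1)) B.W₁ := B.chart₁
/-- The atlas of `W₂`, re-keyed at `3 + 1`. [folklore] -/
instance chart₂' : ChartedSpace (EuclideanHalfSpace (3 + 1)) B.W₂ := B.chart₂
/-- The smooth structure of `W₁`, re-keyed at `3 + 1`. [folklore] -/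
instance mfd₁' : IsManifold (𝓡∂ (3 + 1)) ∞ B.W₁ := B.mfd₁
/-- The smooth structure of `W₂`, re-keyed at `3 + 1`. [folklore] -/
instance mfd₂' : IsManifold (𝓡∂ (3 + 1)) ∞ B.W₂ := B.mfd₂
/-- The boundary manifold `∂W₁` (restricted charts, Lee Thm 5.11). [folklore] -/
instance chartedSpace_bd₁ : ChartedSpace (EuclideanSpace ℝ (Fin 3)) B.Bd₁ :=
  BoundaryManifold.chartedSpace 3 B.W₁
/-- The boundary manifold `∂W₂` (restricted charts, Lee Thm 5.11). [folklore] -/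
instance chartedSpace_bd₂ : ChartedSpace (EuclideanSpace ℝ (Fin 3)) B.Bd₂ :=
  BoundaryManifold.chartedSpace 3 B.W₂
/-- `∂W₁` is a smooth 3-manifold. [folklore] -/
instance isManifold_bd₁ : IsManifold (𝓡 3) ∞ B.Bd₁ := BoundaryManifold.isManifold 3 B.W₁
/-- `∂W₂` is a smooth 3-manifold. [folklore] -/
instance isManifold_bd₂ : IsManifold (𝓡 3) ∞ B.Bd₂ := BoundaryManifold.isManifold 3 B.W₂

/-- `∂W₁` is compact (closed in the compact `W₁`). [folklore] -/
instance compactSpace_bd₁ : CompactSpace B.Bd₁ :=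
  isCompact_iff_compactSpace.mp
    (ModelWithCorners.isClosed_boundary (I := 𝓡∂ 4) (M := B.W₁) (n := ∞) (by simp)).isCompact

/-- `∂W₂` is compact (closed in the compact `W₂`). [folklore] -/
instance compactSpace_bd₂ : CompactSpace B.Bd₂ :=
  isCompact_iff_compactSpace.mp
    (ModelWithCorners.isClosed_boundary (I := 𝓡∂ 4) (M := B.W₂) (n := ∞) (by simp)).isCompact

/-- For `z ∈ ∂W₁` the seam point `e₁ z` is hit by a unique boundary point of `W₂`. [folklore] -/
theorem exists_e₂_eq (z : B.Bd₁) : ∃ w : B.W₂, w ∈ (𝓡∂ 4).boundary B.W₂ ∧ B.e₂ w = B.e₁ z := by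
  have hz : B.e₁ z ∈ B.seam := by rw [seam_eq_image₁]; exact mem_image_of_mem _ z.2
  obtain ⟨-, ⟨w, hw⟩⟩ := hz
  exact ⟨w, B.mem_boundary₂_of_mem_range w ⟨z, hw.symm⟩, hw⟩

/-- For `z ∈ ∂W₂` the seam point `e₂ z` is hit by a unique boundary point of `W₁`. [folklore] -/
theorem exists_e₁_eq (z : B.Bd₂) : ∃ w : B.W₁, w ∈ (𝓡∂ 4).boundary B.W₁ ∧ B.e₁ w = B.e₂ z := by
  have hz : B.e₂ z ∈ B.seam := by rw [seam_eq_image₂]; exact mem_image_of_mem _ z.2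
  obtain ⟨⟨w, hw⟩, -⟩ := hz
  exact ⟨w, B.mem_boundary₁_of_mem_range w ⟨z, hw.symm⟩, hw⟩

/-- The identification of the boundaries `∂W₁ → ∂W₂` through the seam: `e₂ (seamMap z) = e₁ z`.
[folklore] -/
def seamMap (z : B.Bd₁) : B.Bd₂ :=
  ⟨Classical.choose (B.exists_e₂_eq z), (Classical.choose_spec (B.exists_e₂_eq z)).1⟩

/-- `e₂ (seamMap z) = e₁ z`. [folklore] -/
theorem e₂_seamMap (z : B.Bd₁) : B.e₂ (B.seamMap z) = B.e₁ z :=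
  (Classical.choose_spec (B.exists_e₂_eq z)).2

/-- The inverse identification `∂W₂ → ∂W₁`. [folklore] -/
def seamMap' (z : B.Bd₂) : B.Bd₁ :=
  ⟨Classical.choose (B.exists_e₁_eq z), (Classical.choose_spec (B.exists_e₁_eq z)).1⟩

/-- `e₁ (seamMap' z) = e₂ z`. [folklore] -/
theorem e₁_seamMap' (z : B.Bd₂) : B.e₁ (B.seamMap' z) = B.e₂ z :=
  (Classical.choose_spec (B.exists_e₁_eq z)).2

/-- **The gluing bijection `φ : ∂W₁ ≃ ∂W₂`** of a witness (`e₂ ∘ φ = e₁` on `∂W₁`). [folklore] -/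
def seamEquiv : B.Bd₁ ≃ B.Bd₂ where
  toFun := B.seamMap
  invFun := B.seamMap'
  left_inv z := Subtype.ext (B.injective_e₁ (by rw [e₁_seamMap', e₂_seamMap]))
  right_inv z := Subtype.ext (B.injective_e₂ (by rw [e₂_seamMap, e₁_seamMap']))

/-- `e₂ ∘ seamEquiv = e₁` on `∂W₁`. [folklore] -/
@[simp] theorem e₂_seamEquiv (z : B.Bd₁) : B.e₂ (B.seamEquiv z) = B.e₁ z := B.e₂_seamMap z

variable [T2Space M] [SecondCountableTopology M]

/-- The first half as a null-cobordism of its boundary (tree `NullCobordism`; the boundary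
carries the restricted-chart smooth structure `BoundaryManifold.boundaryData`, Lee Thm 5.11).
Reducible, so that instance search sees through `B.nullCobordism₁.W = B.W₁`. [folklore] -/
@[reducible] def nullCobordism₁ : NullCobordism 3 B.Bd₁ :=
  haveI := B.t2Space₁
  haveI := B.secondCountableTopology₁
  { W := B.W₁
    incl := Subtype.val
    isSmoothEmbedding_incl := BoundaryManifold.isSmoothEmbedding_subtype_val
    range_incl := Subtype.range_val }

/-- The second half as a null-cobordism of its boundary. [folklore] -/
@[reducible] def nullCobordism₂ : NullCobordism 3 B.Bd₂ :=
  haveI := B.t2Space₂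
  haveI := B.secondCountableTopology₂
  { W := B.W₂
    incl := Subtype.val
    isSmoothEmbedding_incl := BoundaryManifold.isSmoothEmbedding_subtype_val
    range_incl := Subtype.range_val }

/-- The total space of `nullCobordism₁` is `W₁`. [folklore] -/
@[simp] theorem nullCobordism₁_W : B.nullCobordism₁.W = B.W₁ := rfl
/-- The total space of `nullCobordism₂` is `W₂`. [folklore] -/
@[simp] theorem nullCobordism₂_W : B.nullCobordism₂.W = B.W₂ := rfl

/-- **Every witness of the crux is a boundary gluing `M = W₁ ∪_φ W₂` in the sense of the tree**
(`Literature.Topology.FourManifolds.BoundaryGluingData`, Hirsch Ch. 8 §2): the two smooth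
embeddings cover `M` and meet exactly along `∂W₁ ≡_φ ∂W₂`.  Consequences available to provers at
once: gluing UNIQUENESS (`nonempty_diffeomorph_of_isBoundaryGluing`: `M` is determined up to
diffeomorphism by `(W₁, W₂, φ)` — the rigidity crux is a statement about the triple), the flat
seam charts, `T2`/compactness of `M` from the pieces, and the relative-homology identifications
`Hₖ(W₂, ∂W₂) ≅ Hₖ(M, e₁ W₁)` used in §6. [folklore] -/
def gluingData : BoundaryGluingData B.nullCobordism₁.boundaryData B.nullCobordism₂.boundaryData
    B.seamEquiv M where
  jA := B.e₁
  jB := B.e₂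
  isSmoothEmbedding_jA := B.emb₁
  isSmoothEmbedding_jB := B.emb₂
  range_union := B.cover
  jA_eq_jB_iff a b := by
    constructor
    · intro h
      have ha := (B.mem_boundary_of_eq h).1
      refine ⟨⟨a, ha⟩, rfl, ?_⟩
      apply B.injective_e₂
      change B.e₂ b = B.e₂ (B.seamEquiv ⟨a, ha⟩)
      rw [e₂_seamEquiv, ← h]
    · rintro ⟨z, rfl, rfl⟩
      exact (B.e₂_seamEquiv z).symm

/-- The first embedding of the gluing datum is `e₁`. [folklore] -/
@[simp] theorem gluingData_jA : B.gluingData.jA = B.e₁ := rfl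
/-- The second embedding of the gluing datum is `e₂`. [folklore] -/
@[simp] theorem gluingData_jB : B.gluingData.jB = B.e₂ := rfl

end Witness

/-! ## §6 Homological bookkeeping of a witness: `Hₖ(W₂, ∂W₂) ≅ Hₖ(M, e₁ W₁)`, Lefschetz
duality on the Stein half, and `H₁ = H₂ = H₃ = 0` (over ℚ) for every `M` carrying an acyclic
witness -/

namespace Witness

open Literature.Topology.FourManifolds

variable {M : Type} [TopologicalSpace M] [ChartedSpace 𝔼4 M] (B : Witness M)

/-! More bridging instances, at the forms `2 + 1 + 1` / `2 + 1` produced by the tree's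
`m + 1 + 1`-indexed statements (`BoundaryGluingRelHomology`, `RelFundamentalClassOfOrientation`). -/
/-- The atlas of `W₁`, re-keyed at `2 + 1 + 1`. [folklore] -/
instance chart₁'' : ChartedSpace (EuclideanHalfSpace (2 + 1 + 1)) B.W₁ := B.chart₁
/-- The atlas of `W₂`, re-keyed at `2 + 1 + 1`. [folklore] -/
instance chart₂'' : ChartedSpace (EuclideanHalfSpace (2 + 1 + 1)) B.W₂ := B.chart₂
/-- The smooth structure of `W₁`, re-keyed at `2 + 1 + 1`. [folklore] -/
instance mfd₁'' : IsManifold (𝓡∂ (2 + 1 + 1)) ∞ B.W₁ := B.mfd₁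
/-- The smooth structure of `W₂`, re-keyed at `2 + 1 + 1`. [folklore] -/
instance mfd₂'' : IsManifold (𝓡∂ (2 + 1 + 1)) ∞ B.W₂ := B.mfd₂
/-- The boundary manifold `∂W₁`, re-keyed at `2 + 1`. [folklore] -/
instance chartedSpace_bd₁' : ChartedSpace (EuclideanSpace ℝ (Fin (2 + 1))) B.Bd₁ :=
  BoundaryManifold.chartedSpace 3 B.W₁
/-- The boundary manifold `∂W₂`, re-keyed at `2 + 1`. [folklore] -/
instance chartedSpace_bd₂' : ChartedSpace (EuclideanSpace ℝ (Fin (2 + 1))) B.Bd₂ :=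
  BoundaryManifold.chartedSpace 3 B.W₂
/-- `∂W₁` is smooth, re-keyed at `2 + 1`. [folklore] -/
instance isManifold_bd₁' : IsManifold (𝓡 (2 + 1)) ∞ B.Bd₁ := BoundaryManifold.isManifold 3 B.W₁
/-- `∂W₂` is smooth, re-keyed at `2 + 1`. [folklore] -/
instance isManifold_bd₂' : IsManifold (𝓡 (2 + 1)) ∞ B.Bd₂ := BoundaryManifold.isManifold 3 B.W₂

/-- `∂W₂` is Hausdorff when `M` is. [folklore] -/
instance t2Space_bd₂ [T2Space M] : T2Space B.Bd₂ := by
  haveI := B.t2Space₂; infer_instance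

/-- `∂W₂ ≠ ∅` over a nonempty `M`. [folklore] -/
theorem nonempty_bd₂ [Nonempty M] : Nonempty B.Bd₂ :=
  let ⟨w, hw⟩ := B.boundaries_nonempty.2; ⟨⟨w, hw⟩⟩

/-- `e₂` as a continuous map. [folklore] -/
def e₂CM : C(B.W₂, M) := ⟨B.e₂, B.continuous_e₂⟩

/-- `e₂` maps `∂W₂` into `e₁ W₁` (a map of pairs `(W₂, ∂W₂) → (M, e₁W₁)`). [folklore] -/
theorem mapsTo_e₂_boundary : MapsTo B.e₂ ((𝓡∂ 4).boundary B.W₂) (range B.e₁) := by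
  intro w hw
  have : B.e₂ w ∈ B.seam := by rw [seam_eq_image₂]; exact mem_image_of_mem _ hw
  exact this.1

/-- In an acyclic witness, `Hₖ(e₁ W₁; ℚ) = 0` for `k > 0` (`e₁` is a homeomorphism onto its
image). [folklore] -/
theorem isZero_homology_range_e₁ (hB : B.Acyclic) {k : ℕ} (hk : 0 < k) :
    IsZero (singularHomology ℚ ℚ ↥(range B.e₁) k) :=
  (hB k hk).1.of_iso (singularHomology.mapIso ℚ ℚ B.emb₁.isEmbedding.toHomeomorph k).symm

/-- In an acyclic witness, `j_* : Hₖ(M) → Hₖ(M, e₁ W₁)` is injective for `k > 0`. [folklore] -/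
theorem mono_ofAbsolute (hB : B.Acyclic) {k : ℕ} (hk : 0 < k) :
    Mono (relativeSingularHomology.ofAbsolute ℚ ℚ M (range B.e₁) k) :=
  (relativeSingularHomology.exact_map_ofAbsolute ℚ ℚ (range B.e₁) k).mono_g
    ((B.isZero_homology_range_e₁ hB hk).eq_of_src _ _)

/-- In an acyclic witness, `j_* : Hₖ₊₁(M) → Hₖ₊₁(M, e₁ W₁)` is surjective for `k > 0`. [folklore] -/
theorem epi_ofAbsolute (hB : B.Acyclic) {k : ℕ} (hk : 0 < k) :
    Epi (relativeSingularHomology.ofAbsolute ℚ ℚ M (range B.e₁) (k + 1)) :=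
  (relativeSingularHomology.exact_ofAbsolute_δ ℚ ℚ (range B.e₁) k).epi_f
    ((B.isZero_homology_range_e₁ hB hk).eq_of_tgt _ _)

variable [T2Space M] [SecondCountableTopology M]

/-- **`(e₂)_* : Hₖ(W₂, ∂W₂; G) ≅ Hₖ(M, e₁ W₁; G)`** for every witness over a nonempty `M` and
all coefficients (excision + collar slide; the tree's
`BoundaryGluingData.isIso_map_jB_boundary'`, Hatcher Thm 2.20 / Prop 2.22). [folklore] -/
theorem isIso_relMap₂ [IsManifold (𝓡 4) ∞ M] [Nonempty M] (R : Type) [CommRing R] (Gr : Type)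
    [AddCommGroup Gr] [Module R Gr] (k : ℕ) :
    IsIso (relativeSingularHomology.map R Gr B.e₂CM B.mapsTo_e₂_boundary k) := by
  haveI := B.nonempty_bd₂
  exact B.gluingData.isIso_map_jB_boundary' R Gr k

/-- **The Stein half `W₂` carries a relative fundamental class over ℚ.**  The Stein structure
orients `W₂` (`SteinStructure.complexOrientation`), whence an integral relative fundamental class
(`NullCobordism.exists_isRelFundamentalClass_of_smoothOrientation`), an orientation of the
external collar (`ExtCollar.orientation`), its ℚ-version (`HomologicalOrientation.toCoeff`) and a
ℚ relative fundamental class (`ExtCollar.exists_isRelFundamentalClass_of_orientation`).  All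
inputs are PROVED tree theorems. [folklore] -/
theorem exists_isRelFundamentalClass_rat₂ [Nonempty M] :
    ∃ zq : relativeSingularHomology ℚ ℚ B.W₂ ((𝓡∂ (2 + 1 + 1)).boundary B.W₂) (2 + 1 + 1),
      IsRelFundamentalClass ℚ ((𝓡∂ (2 + 1 + 1)).boundary B.W₂) zq := by
  haveI := B.t2Space₂
  haveI := B.nonempty_bd₂
  obtain ⟨z, hz⟩ :=
    B.nullCobordism₂.exists_isRelFundamentalClass_of_smoothOrientation B.J₂.complexOrientation
  exact ExtCollar.exists_isRelFundamentalClass_of_orientation (R := ℚ) (2 + 1)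
    ((ExtCollar.orientation z hz).toCoeff ℚ)

/-- **Lefschetz duality on the Stein half**: `a ↦ a ⌢ [W₂, ∂W₂]` is a bijection
`Hᵖ(W₂; ℚ) → H_q(W₂, ∂W₂; ℚ)` for `p + q = 4` (tree
`bijective_relCapProduct_of_isRelFundamentalClass_holds`, Spanier 6.3.12 / Hatcher 3.43).
[folklore] -/
theorem exists_lefschetz₂ [Nonempty M] {p q : ℕ} (h : p + q = 2 + 1 + 1) :
    ∃ zq : relativeSingularHomology ℚ ℚ B.W₂ ((𝓡∂ (2 + 1 + 1)).boundary B.W₂) (2 + 1 + 1),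
      Function.Bijective fun a : singularCohomology ℚ ℚ B.W₂ p =>
        relCapProduct (M := ℚ) ((𝓡∂ (2 + 1 + 1)).boundary B.W₂) h a zq := by
  haveI := B.t2Space₂
  obtain ⟨zq, hzq⟩ := B.exists_isRelFundamentalClass_rat₂
  exact ⟨zq, bijective_relCapProduct_of_isRelFundamentalClass_holds (R := ℚ) (2 + 1) B.W₂ zq hzq h⟩

/-- **Lefschetz vanishing on the Stein half.**  If `W₂` is ℚ-acyclic in positive degrees then
`H_q(W₂, ∂W₂; ℚ) = 0` whenever `p + q = 4` with `0 < p`: Lefschetz duality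
`Hᵖ(W₂; ℚ) ≅ H_q(W₂, ∂W₂; ℚ)` (`exists_lefschetz₂`) and `Hᵖ(W₂; ℚ) = 0` by the field universal
coefficient theorem (`kroneckerPairing_injective_of_field`) from `Hₚ(W₂; ℚ) = 0`. [folklore] -/
theorem isZero_relHomology₂ [Nonempty M] (hB : B.AcyclicRight) {p q : ℕ} (hp : 0 < p)
    (h : p + q = 2 + 1 + 1) :
    IsZero (relativeSingularHomology ℚ ℚ B.W₂ ((𝓡∂ (2 + 1 + 1)).boundary B.W₂) q) := by
  haveI := B.t2Space₂
  -- (1)–(3) Lefschetz duality over ℚ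
  obtain ⟨zq, hbij⟩ := B.exists_lefschetz₂ h
  -- (4) `Hᵖ(W₂; ℚ)` is trivial
  haveI : Subsingleton (singularHomology ℚ ℚ B.W₂ p) := ModuleCat.subsingleton_of_isZero (hB p hp)
  have hsub : Subsingleton (singularCohomology ℚ ℚ B.W₂ p) :=
    ⟨fun a b => kroneckerPairing_injective_of_field ℚ B.W₂ p
      (LinearMap.ext fun c => by rw [Subsingleton.elim c 0, map_zero, map_zero])⟩
  -- (5) so is the target of the duality bijection
  haveI : Subsingleton (relativeSingularHomology ℚ ℚ B.W₂ ((𝓡∂ (2 + 1 + 1)).boundary B.W₂) q) :=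
    ⟨fun x y => by
      obtain ⟨a, rfl⟩ := hbij.2 x
      obtain ⟨b, rfl⟩ := hbij.2 y
      rw [Subsingleton.elim a b]⟩
  exact ModuleCat.isZero_of_subsingleton _

/-- **Any `M` carrying an acyclic witness is a ℚ-homology sphere in degrees `1, 2, 3`**:
`Hₖ(M; ℚ) ↪ Hₖ(M, e₁ W₁; ℚ) ≅ Hₖ(W₂, ∂W₂; ℚ) = 0`.  This is exactly how the hypothesis
`M ≃ₕ S⁴` is USED by the statement: it cannot be weakened to "closed simply connected"
(§7, `ℂℙ²`). [folklore] -/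
theorem isZero_homology_of_acyclic [IsManifold (𝓡 4) ∞ M] [Nonempty M] (hB : B.Acyclic) {k : ℕ}
    (hk : 0 < k) (hk3 : k ≤ 3) : IsZero (singularHomology ℚ ℚ M k) := by
  haveI := B.mono_ofAbsolute hB hk
  haveI := B.isIso_relMap₂ ℚ ℚ k
  have hrel : IsZero (relativeSingularHomology ℚ ℚ M (range B.e₁) k) :=
    (B.isZero_relHomology₂ hB.right (p := 4 - k) (q := k) (by omega) (by omega)).of_iso
      (asIso (relativeSingularHomology.map ℚ ℚ B.e₂CM B.mapsTo_e₂_boundary k)).symm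
  exact IsZero.of_mono (relativeSingularHomology.ofAbsolute ℚ ℚ M (range B.e₁) k) hrel

/-- **The seam of an acyclic witness is a ℚ-homology sphere in degrees 1 and 2** — over ANY
nonempty `M` (no homotopy-sphere hypothesis): `H₁(∂W₂; ℚ) = H₂(∂W₂; ℚ) = 0`, from the exact
`Hₖ₊₁(W₂, ∂W₂) → Hₖ(∂W₂) → Hₖ(W₂)` with both ends zero (`isZero_relHomology₂`, acyclicity).  This
is the proved half of the informal gloss "(⇔ seam a connected ℚHS³)" in the crux text. [folklore] -/
theorem isZero_homology_bd₂ [Nonempty M] (hB : B.AcyclicRight) {k : ℕ} (hk : 0 < k) (hk2 : k ≤ 2) :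
    IsZero (singularHomology ℚ ℚ B.Bd₂ k) := by
  have hrel := B.isZero_relHomology₂ hB (p := 3 - k) (q := k + 1) (by omega) (by omega)
  exact (relativeSingularHomology.exact_δ_map ℚ ℚ ((𝓡∂ 4).boundary B.W₂) k).isZero_of_both_zeros
    (hrel.eq_of_src _ _) ((hB k hk).eq_of_tgt _ _)

end Witness

/-! ### Swapping the halves: every `₂`-statement above holds for `W₁` as well -/

namespace Witness

variable {M : Type} [TopologicalSpace M] [ChartedSpace 𝔼4 M]

/-- **Swap the two halves of a witness.** The crux's conditions are symmetric in `(W₁, W₂)`.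
[folklore] -/
def swap (B : Witness M) : Witness M where
  W₁ := B.W₂
  W₂ := B.W₁
  J₁ := B.J₂
  J₂ := B.J₁
  e₁ := B.e₂
  e₂ := B.e₁
  emb₁ := B.emb₂
  emb₂ := B.emb₁
  cover := by rw [union_comm]; exact B.cover
  inter₁ := by rw [inter_comm]; exact B.inter₂
  inter₂ := by rw [inter_comm]; exact B.inter₁
  contact w₂ w₁ h := (B.contact w₁ w₂ h.symm).symm

/-- The first half of the swapped witness is `W₂`. [folklore] -/
@[simp] theorem swap_W₁ (B : Witness M) : B.swap.W₁ = B.W₂ := rfl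
/-- The second half of the swapped witness is `W₁`. [folklore] -/
@[simp] theorem swap_W₂ (B : Witness M) : B.swap.W₂ = B.W₁ := rfl
/-- The first embedding of the swapped witness is `e₂`. [folklore] -/
@[simp] theorem swap_e₁ (B : Witness M) : B.swap.e₁ = B.e₂ := rfl
/-- The second embedding of the swapped witness is `e₁`. [folklore] -/
@[simp] theorem swap_e₂ (B : Witness M) : B.swap.e₂ = B.e₁ := rfl

/-- Acyclicity is symmetric under swapping the halves. [folklore] -/
theorem Acyclic.swap {B : Witness M} (hB : B.Acyclic) : B.swap.Acyclic :=
  fun k hk => ⟨(hB k hk).2, (hB k hk).1⟩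

/-- Left acyclicity becomes right acyclicity of the swapped witness. [folklore] -/
theorem AcyclicLeft.swap {B : Witness M} (hB : B.AcyclicLeft) : B.swap.AcyclicRight := hB
/-- Right acyclicity becomes left acyclicity of the swapped witness. [folklore] -/
theorem AcyclicRight.swap {B : Witness M} (hB : B.AcyclicRight) : B.swap.AcyclicLeft := hB

/-- Connectedness of `W₂` seen as the first half of the swapped witness. [folklore] -/
instance connectedSpace_swap_W₁ (B : Witness M) [h : ConnectedSpace B.W₂] : ConnectedSpace B.swap.W₁ := h
/-- Connectedness of `W₁` seen as the second half of the swapped witness. [folklore] -/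
instance connectedSpace_swap_W₂ (B : Witness M) [h : ConnectedSpace B.W₁] : ConnectedSpace B.swap.W₂ := h

variable [T2Space M] [SecondCountableTopology M] (B : Witness M)

/-- Lefschetz vanishing on the FIRST half: `H_q(W₁, ∂W₁; ℚ) = 0` for `p + q = 4`, `0 < p`, in an
acyclic witness. [folklore] -/
theorem isZero_relHomology₁ [Nonempty M] (hB : B.AcyclicLeft) {p q : ℕ} (hp : 0 < p)
    (h : p + q = 2 + 1 + 1) :
    IsZero (relativeSingularHomology ℚ ℚ B.W₁ ((𝓡∂ (2 + 1 + 1)).boundary B.W₁) q) :=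
  B.swap.isZero_relHomology₂ hB.swap hp h

/-- `H₁(∂W₁; ℚ) = H₂(∂W₁; ℚ) = 0` as soon as the FIRST half is acyclic. [folklore] -/
theorem isZero_homology_bd₁ [Nonempty M] (hB : B.AcyclicLeft) {k : ℕ} (hk : 0 < k) (hk2 : k ≤ 2) :
    IsZero (singularHomology ℚ ℚ B.Bd₁ k) :=
  B.swap.isZero_homology_bd₂ hB.swap hk hk2

end Witness

/-! ## §8 Homology control on ONE half suffices (gen-1 near-miss `isZero_homology_right_of_left`)

Over an `M` with the ℚ-homology of `S⁴`, if `W₁` is ℚ-acyclic then so is `W₂`, provided both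
halves are connected: degrees `1, 2` from the pair sequence of `(M, e₂ W₂)` and Lefschetz
vanishing on `W₁`; degree `3` by a dimension count `H₄(M) ≅ ℚ ↪ H₄(M, e₂W₂) ≅ H₄(W₁, ∂W₁) ≅ H⁰(W₁) ≅ ℚ`;
degrees `≥ 4` because a connected manifold with nonempty boundary has no homology from the top
dimension on (external collar + Hatcher Prop 3.29). -/

section ExtCollarConnected

open Literature.AlgebraicTopology.SingularHomology

/-- The external collar of a connected space is connected (every point is joined to `W` by the
squeeze homotopy). [folklore] -/
theorem connectedSpace_extCollar (n : ℕ) (W : Type) [TopologicalSpace W]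
    [ChartedSpace (EuclideanHalfSpace (n + 1)) W] [ConnectedSpace W] : ConnectedSpace (ExtCollar n W) := by
  let x₀ : ExtCollar n W := ExtCollar.incl n (Classical.arbitrary W)
  let T : ExtCollar n W → Set (ExtCollar n W) := fun x =>
    range (ExtCollar.incl n) ∪ range (fun t : unitInterval => ExtCollar.squeezeHomotopy (t, x))
  have hT : ∀ x, IsPreconnected (T x) := fun x =>
    IsPreconnected.union (ExtCollar.incl n (ExtCollar.base x)) ⟨_, rfl⟩
      ⟨0, ExtCollar.squeezeHomotopy.apply_zero x⟩
      (isPreconnected_range ExtCollar.continuous_incl)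
      (isPreconnected_range (ExtCollar.squeezeHomotopy.continuous.comp
        (continuous_id.prodMk continuous_const)))
  have hcover : ⋃₀ (range T) = univ := by
    refine eq_univ_of_forall fun x => ⟨T x, ⟨x, rfl⟩, Or.inr ⟨1, ?_⟩⟩
    exact ExtCollar.squeezeHomotopy.apply_one x
  rw [connectedSpace_iff_univ, ← hcover]
  refine ⟨⟨x₀, T x₀, ⟨x₀, rfl⟩, Or.inl ⟨_, rfl⟩⟩, isPreconnected_sUnion x₀ _ ?_ ?_⟩
  · rintro _ ⟨x, rfl⟩; exact Or.inl ⟨_, rfl⟩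
  · rintro _ ⟨x, rfl⟩; exact hT x

end ExtCollarConnected

namespace Witness

open Literature.Topology.FourManifolds

variable {M : Type} [TopologicalSpace M] [ChartedSpace 𝔼4 M] (B : Witness M)

/-- **No homology from the top dimension on**: `Hₖ(W₂; G) = 0` for `k ≥ 4` when `W₂` is
connected, over a nonempty `M` (so `∂W₂ ≠ ∅`): `W₂ ≃ W₂ ∪ collar` (`homotopyEquivExtCollar`),
a connected NON-COMPACT 4-manifold (`ExtCollar.noncompactSpace_of_nonempty_boundary`), whose
homology vanishes from degree 4 on (Hatcher Prop 3.29, tree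
`clocalHomology.isZero_singularHomology_of_noncompact`). [folklore] -/
theorem isZero_homology₂_of_four_le [T2Space M] [Nonempty M] [ConnectedSpace B.W₂] {k : ℕ}
    (hk : 4 ≤ k) : IsZero (singularHomology ℚ ℚ B.W₂ k) := by
  haveI := B.t2Space₂
  haveI : NoncompactSpace (ExtCollar 3 B.W₂) :=
    ExtCollar.noncompactSpace_of_nonempty_boundary B.boundaries_nonempty.2
  haveI : ConnectedSpace (ExtCollar 3 B.W₂) := connectedSpace_extCollar 3 B.W₂
  exact (clocalHomology.isZero_singularHomology_of_noncompact ℚ ℚ (X := ExtCollar 3 B.W₂)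
    (n := 3 + 1) hk).of_iso (singularHomology.isoOfHomotopyEquiv ℚ ℚ (homotopyEquivExtCollar 3 B.W₂) k)

variable [T2Space M] [SecondCountableTopology M] [IsManifold (𝓡 4) ∞ M] [Nonempty M]

/-- Degrees `1, 2`: if `W₁` is ℚ-acyclic and `Hₖ(M; ℚ) = 0` (`k = 1, 2`) then `Hₖ(W₂; ℚ) = 0`,
from the exact `Hₖ₊₁(M, e₂W₂) → Hₖ(e₂W₂) → Hₖ(M)` and
`Hₖ₊₁(M, e₂W₂) ≅ Hₖ₊₁(W₁, ∂W₁) = 0` (Lefschetz vanishing on `W₁`). [folklore] -/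
theorem isZero_homology₂_low (h₁ : B.AcyclicLeft) {k : ℕ} (hk : 0 < k) (hk2 : k ≤ 2)
    (hM : IsZero (singularHomology ℚ ℚ M k)) : IsZero (singularHomology ℚ ℚ B.W₂ k) := by
  refine IsZero.of_iso ?_ (singularHomology.mapIso ℚ ℚ B.emb₂.isEmbedding.toHomeomorph k)
  haveI := B.swap.isIso_relMap₂ ℚ ℚ (k + 1)
  have hrel : IsZero (relativeSingularHomology ℚ ℚ M (range B.e₂) (k + 1)) :=
    (B.isZero_relHomology₁ h₁ (p := 3 - k) (q := k + 1) (by omega) (by omega)).of_iso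
      (asIso (relativeSingularHomology.map ℚ ℚ B.swap.e₂CM B.swap.mapsTo_e₂_boundary (k + 1))).symm
  exact (relativeSingularHomology.exact_δ_map ℚ ℚ (range B.e₂) k).isZero_of_both_zeros
    (hrel.eq_of_src _ _) (hM.eq_of_tgt _ _)

/-- `dim_ℚ H₄(M, e₂W₂; ℚ) = 1` when `W₁` is connected:
`H₄(M, e₂W₂) ≅ H₄(W₁, ∂W₁) ≅ H⁰(W₁; ℚ)` (gluing iso, Lefschetz on `W₁`) and
`dim H⁰ = dim H₀ = 1` (field UCT, `W₁` path connected). [folklore] -/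
theorem finrank_relHomology_four [ConnectedSpace B.W₁] :
    Module.finrank ℚ (relativeSingularHomology ℚ ℚ M (range B.e₂) 4) = 1 := by
  haveI := B.t2Space₁
  -- `H₄(W₁, ∂W₁) ≅ H₄(M, e₂W₂)`
  haveI := B.swap.isIso_relMap₂ ℚ ℚ 4
  have e1 : relativeSingularHomology ℚ ℚ B.W₁ ((𝓡∂ 4).boundary B.W₁) 4 ≃ₗ[ℚ]
      relativeSingularHomology ℚ ℚ M (range B.e₂) 4 :=
    (asIso (relativeSingularHomology.map ℚ ℚ B.swap.e₂CM B.swap.mapsTo_e₂_boundary 4)).toLinearEquiv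
  rw [← e1.finrank_eq]
  -- Lefschetz on `W₁`: `H⁰(W₁; ℚ) ≃ H₄(W₁, ∂W₁; ℚ)`
  obtain ⟨zq, hbij⟩ := B.swap.exists_lefschetz₂ (p := 0) (q := 2 + 1 + 1) rfl
  rw [← (LinearEquiv.ofBijective ((relCapProduct (M := ℚ) ((𝓡∂ (2 + 1 + 1)).boundary B.W₁)
    (show 0 + (2 + 1 + 1) = 2 + 1 + 1 from rfl)).flip zq) hbij).finrank_eq]
  -- `dim H⁰(W₁; ℚ) = dim H₀(W₁; ℚ) = 1`
  rw [finrank_singularCohomology_eq_bettiNumber_of_field ℚ B.W₁ 0, bettiNumber]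
  haveI : LocallyPathConnectedSpace B.W₁ :=
    ChartedSpace.locallyPathConnectedSpace (EuclideanHalfSpace 4) B.W₁
  haveI : PathConnectedSpace B.W₁ := pathConnectedSpace_iff_connectedSpace.mpr ‹_›
  haveI := singularHomology.isIso_ε_of_pathConnectedSpace ℚ ℚ (X := B.W₁)
  rw [(asIso (singularHomology.ε ℚ ℚ B.W₁)).toLinearEquiv.finrank_eq]
  change Module.finrank ℚ (ULift.{0} ℚ) = 1
  rw [ULift.moduleEquiv.finrank_eq, Module.finrank_self]

/-- Degree `3`: if `H₃(M; ℚ) = 0`, `dim H₄(M; ℚ) = 1` and both halves are connected then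
`H₃(W₂; ℚ) = 0` — `j : H₄(M) → H₄(M, e₂W₂)` is injective (`H₄(e₂W₂) = 0`) between
1-dimensional spaces, hence onto, so `∂ : H₄(M, e₂W₂) → H₃(e₂W₂)` vanishes while being onto
(`H₃(M) = 0`). [folklore] -/
theorem isZero_homology₂_three [ConnectedSpace B.W₁] [ConnectedSpace B.W₂]
    (hM3 : IsZero (singularHomology ℚ ℚ M 3))
    (hM4 : Module.finrank ℚ (singularHomology ℚ ℚ M 4) = 1) :
    IsZero (singularHomology ℚ ℚ B.W₂ 3) := by
  have eA : B.W₂ ≃ₜ ↥(range B.e₂) := B.emb₂.isEmbedding.toHomeomorph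
  -- `j` is injective
  have hA4 : IsZero (singularHomology ℚ ℚ ↥(range B.e₂) 4) :=
    (B.isZero_homology₂_of_four_le le_rfl).of_iso (singularHomology.mapIso ℚ ℚ eA 4).symm
  have hmono : Mono (relativeSingularHomology.ofAbsolute ℚ ℚ M (range B.e₂) 4) :=
    (relativeSingularHomology.exact_map_ofAbsolute ℚ ℚ (range B.e₂) 4).mono_g (hA4.eq_of_src _ _)
  have hinj := (ModuleCat.mono_iff_injective _).mp hmono
  -- hence onto, by the dimension count
  have hfin := B.finrank_relHomology_four
  haveI : Module.Finite ℚ (singularHomology ℚ ℚ M 4) := Module.finite_of_finrank_eq_succ hM4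
  haveI : Module.Finite ℚ (relativeSingularHomology ℚ ℚ M (range B.e₂) 4) :=
    Module.finite_of_finrank_eq_succ hfin
  have hsurj : Function.Surjective (relativeSingularHomology.ofAbsolute ℚ ℚ M (range B.e₂) 4).hom :=
    (LinearMap.injective_iff_surjective_of_finrank_eq_finrank (by rw [hM4, hfin])).mp hinj
  haveI : Epi (relativeSingularHomology.ofAbsolute ℚ ℚ M (range B.e₂) 4) :=
    (ModuleCat.epi_iff_surjective _).mpr hsurj
  have hδ : relativeSingularHomology.δ ℚ ℚ M (range B.e₂) 3 = 0 :=
    zero_of_epi_comp (relativeSingularHomology.ofAbsolute ℚ ℚ M (range B.e₂) 4)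
      (relativeSingularHomology.ofAbsolute_comp_δ ℚ ℚ (range B.e₂) 3)
  -- so `H₃(e₂ W₂) = 0`
  have hA3 : IsZero (singularHomology ℚ ℚ ↥(range B.e₂) 3) :=
    (relativeSingularHomology.exact_δ_map ℚ ℚ (range B.e₂) 3).isZero_of_both_zeros hδ
      (hM3.eq_of_tgt _ _)
  exact hA3.of_iso (singularHomology.mapIso ℚ ℚ eA 3)

/-- **Homology control on one half suffices.**  Over an `M` with the ℚ-homology of `S⁴` in
degrees `1 … 4` and with both halves connected, `W₁` ℚ-acyclic ⇒ `W₂` ℚ-acyclic.  (Provers: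
the conjunct `IsZero (H_k W₂)` of the crux is then free; planners: a one-sided restatement is
equivalent modulo connectedness.) [folklore] -/
theorem acyclicRight_of_acyclicLeft [ConnectedSpace B.W₁] [ConnectedSpace B.W₂] (h₁ : B.AcyclicLeft)
    (hM : ∀ k, 0 < k → k ≤ 3 → IsZero (singularHomology ℚ ℚ M k))
    (hM4 : Module.finrank ℚ (singularHomology ℚ ℚ M 4) = 1) : B.AcyclicRight := by
  intro k hk
  rcases Nat.lt_or_ge k 3 with h | h
  · exact B.isZero_homology₂_low h₁ hk (by omega) (hM k hk (by omega))
  rcases Nat.lt_or_ge k 4 with h' | h'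
  · obtain rfl : k = 3 := by omega
    exact B.isZero_homology₂_three (hM 3 (by norm_num) le_rfl) hM4
  · exact B.isZero_homology₂_of_four_le h'

omit [ChartedSpace 𝔼4 M] [T2Space M] [SecondCountableTopology M] [IsManifold (𝓡 4) ∞ M] [Nonempty M] in
/-- The ℚ-homology of a homotopy 4-sphere: `Hₖ(M; ℚ) = 0` for `0 < k`, `k ≠ 4` (tree
`isZero_singularHomology_sphere_holds`, Hatcher Cor 2.14, transported by homotopy invariance).
[folklore] -/
theorem isZero_homology_of_homotopyEquiv_sphere (e : M ≃ₕ 𝕊⁴) {k : ℕ} (hk : k ≠ 0) (hk4 : k ≠ 4) :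
    IsZero (singularHomology ℚ ℚ M k) :=
  (isZero_singularHomology_sphere_holds ℚ ℚ (n := 4) hk hk4).of_iso
    (singularHomology.isoOfHomotopyEquiv ℚ ℚ e k)

omit [ChartedSpace 𝔼4 M] [T2Space M] [SecondCountableTopology M] [IsManifold (𝓡 4) ∞ M] [Nonempty M] in
/-- `dim H₄(M; ℚ) = 1` for a homotopy 4-sphere (tree `singularHomologyUnitSphereIso`). [folklore] -/
theorem finrank_homology_four_of_homotopyEquiv_sphere (e : M ≃ₕ 𝕊⁴) :
    Module.finrank ℚ (singularHomology ℚ ℚ M 4) = 1 := by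
  rw [(singularHomology.isoOfHomotopyEquiv ℚ ℚ e 4 ≪≫
    singularHomologyUnitSphereIso ℚ ℚ 4 (by norm_num)).toLinearEquiv.finrank_eq]
  exact Module.finrank_self ℚ

/-- **In the crux's own setting (`M ≃ₕ S⁴`), the ℚ-acyclicity of `W₂` follows from that of `W₁`
once both halves are connected.** [folklore] -/
theorem acyclicRight_of_acyclicLeft_of_homotopyEquiv (e : M ≃ₕ 𝕊⁴) [ConnectedSpace B.W₁]
    [ConnectedSpace B.W₂] (h₁ : B.AcyclicLeft) : B.AcyclicRight :=
  B.acyclicRight_of_acyclicLeft h₁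
    (fun k hk hk3 => isZero_homology_of_homotopyEquiv_sphere e (by omega) (by omega))
    (finrank_homology_four_of_homotopyEquiv_sphere e)

end Witness

/-! ## §9 Connectedness bookkeeping: `W₁` connected and ℚ-acyclic ⇒ seam connected ⇒ `W₂`
connected (removes the hypothesis `[ConnectedSpace W₂]` of §8 and proves the "connected" half of
the crux's gloss "seam a connected ℚHS³") -/

section HZero

open Literature.AlgebraicTopology.SingularHomology

variable {Z Y : Type} [TopologicalSpace Z] [TopologicalSpace Y]

/-- The class of a point in `H₀(Z; ℚ)`: the image of the generator `ε⁻¹(1)` of `H₀(pt; ℚ)`.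
[folklore] -/
def pointClass (z : Z) : singularHomology ℚ ℚ Z 0 :=
  haveI := singularHomology.isIso_ε_of_pathConnectedSpace ℚ ℚ (X := PUnit.{1})
  singularHomology.map ℚ ℚ (ContinuousMap.const PUnit.{1} z) 0
    (inv (singularHomology.ε ℚ ℚ PUnit.{1}) (ULift.up 1))

/-- `ε [z] = 1`. [folklore] -/
theorem ε_pointClass (z : Z) : singularHomology.ε ℚ ℚ Z (pointClass z) = ULift.up 1 := by
  haveI := singularHomology.isIso_ε_of_pathConnectedSpace ℚ ℚ (X := PUnit.{1})
  change (singularHomology.map ℚ ℚ (ContinuousMap.const PUnit.{1} z) 0 ≫ singularHomology.ε ℚ ℚ Z)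
    (inv (singularHomology.ε ℚ ℚ PUnit.{1}) (ULift.up 1)) = _
  rw [singularHomology.map_ε]
  change (inv (singularHomology.ε ℚ ℚ PUnit.{1}) ≫ singularHomology.ε ℚ ℚ PUnit.{1}) _ = _
  rw [IsIso.inv_hom_id]
  rfl

/-- `f_* [z] = [f z]`. [folklore] -/
theorem map_pointClass (f : C(Z, Y)) (z : Z) :
    singularHomology.map ℚ ℚ f 0 (pointClass z) = pointClass (f z) := by
  unfold pointClass
  change (singularHomology.map ℚ ℚ (ContinuousMap.const PUnit.{1} z) 0 ≫ singularHomology.map ℚ ℚ f 0) _ = _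
  rw [← singularHomology.map_comp]
  rfl

/-- In a path-connected space all point classes agree (`ε` is an isomorphism). [folklore] -/
theorem pointClass_eq_of_pathConnectedSpace [PathConnectedSpace Z] (z z' : Z) :
    pointClass z = pointClass z' := by
  haveI := singularHomology.isIso_ε_of_pathConnectedSpace ℚ ℚ (X := Z)
  apply ((ModuleCat.mono_iff_injective (singularHomology.ε ℚ ℚ Z)).mp inferInstance)
  rw [ε_pointClass, ε_pointClass]

/-- **`H₀` detects components**: if all point classes of a locally connected space `Z` agree in
`H₀(Z; ℚ)`, then `Z` is preconnected (clopen additivity of `H₀`, Hatcher Prop 2.6, tree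
`singularHomology.eq_zero_of_sum_map_subsetIncl_eq_zero`). [folklore] -/
theorem preconnectedSpace_of_pointClass_eq [LocallyConnectedSpace Z]
    (h : ∀ z z' : Z, pointClass z = pointClass z') : PreconnectedSpace Z := by
  rw [preconnectedSpace_iff_connectedComponent]
  intro z₀
  by_contra hU
  obtain ⟨z₁, hz₁⟩ : ∃ z₁, z₁ ∉ connectedComponent z₀ := (Set.ne_univ_iff_exists_notMem _).mp hU
  -- the clopen partition `{C, Cᶜ}`, `C` the component of `z₀`
  let A : Bool → Set Z := fun b => bif b then connectedComponent z₀ else (connectedComponent z₀)ᶜ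
  have hA : IsClopenPartition A :=
    { isOpen := fun b => by
        cases b
        · exact isClosed_connectedComponent.isOpen_compl
        · exact isOpen_connectedComponent
      disjoint := fun j k hjk => by
        cases j <;> cases k
        · exact (hjk rfl).elim
        · exact disjoint_compl_left
        · exact disjoint_compl_right
        · exact (hjk rfl).elim
      exists_mem := fun z => by
        by_cases hz : z ∈ connectedComponent z₀
        · exact ⟨true, hz⟩
        · exact ⟨false, hz⟩ }
  let x : ∀ b, singularHomology ℚ ℚ (A b) 0 := fun b =>
    match b with
    | true => pointClass (⟨z₀, mem_connectedComponent⟩ : A true)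
    | false => -pointClass (⟨z₁, hz₁⟩ : A false)
  have hsum : ∑ b ∈ Finset.univ, singularHomology.map ℚ ℚ (subsetIncl (A b)) 0 (x b) = 0 := by
    rw [Finset.sum_eq_add_of_mem (a := true) (b := false) (Finset.mem_univ _) (Finset.mem_univ _)
      (by decide) (fun c _ hc => by cases c <;> simp at hc)]
    change singularHomology.map ℚ ℚ (subsetIncl (A true)) 0 (pointClass _) +
      singularHomology.map ℚ ℚ (subsetIncl (A false)) 0 (-pointClass _) = 0
    rw [map_neg, map_pointClass, map_pointClass, h _ z₁]
    exact add_neg_cancel _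
  have hx := singularHomology.eq_zero_of_sum_map_subsetIncl_eq_zero (R := ℚ) (M := ℚ) hA 0
    Finset.univ x hsum true (Finset.mem_univ _)
  have key := congrArg (singularHomology.ε ℚ ℚ (A true)) hx
  change singularHomology.ε ℚ ℚ (A true) (pointClass _) = _ at key
  rw [ε_pointClass, map_zero] at key
  exact one_ne_zero (congrArg ULift.down key)

end HZero

namespace Witness

open Literature.Topology.FourManifolds

variable {M : Type} [TopologicalSpace M] [ChartedSpace 𝔼4 M] (B : Witness M)

/-- The boundary identification as a CONTINUOUS map: `e₂⁻¹ ∘ e₁` on `∂W₁`. [folklore] -/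
theorem continuous_seamMap : Continuous B.seamMap := by
  let g : B.Bd₁ → B.W₂ := fun z =>
    B.emb₂.isEmbedding.toHomeomorph.symm ⟨B.e₁ z, B.seam_subset_range_e₂
      (by rw [seam_eq_image₁]; exact mem_image_of_mem _ z.2)⟩
  have hg : Continuous g := B.emb₂.isEmbedding.toHomeomorph.symm.continuous.comp
    ((B.continuous_e₁.comp continuous_subtype_val).subtype_mk _)
  have hge : ∀ z, B.e₂ (g z) = B.e₁ z := fun z => by
    change ((B.emb₂.isEmbedding.toHomeomorph (B.emb₂.isEmbedding.toHomeomorph.symm _)) : M) = _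
    rw [Homeomorph.apply_symm_apply]
  have heq : B.seamMap = fun z => ⟨g z, B.mem_boundary₂_of_mem_range (g z) ⟨z, (hge z).symm⟩⟩ := by
    funext z
    exact Subtype.ext (B.injective_e₂ ((B.e₂_seamMap z).trans (hge z).symm))
  rw [heq]
  exact hg.subtype_mk _

/-- **The seam identification `∂W₁ ≃ₜ ∂W₂` is a homeomorphism.** [folklore] -/
def seamHomeomorph : B.Bd₁ ≃ₜ B.Bd₂ where
  toEquiv := B.seamEquiv
  continuous_toFun := B.continuous_seamMap
  continuous_invFun := B.swap.continuous_seamMap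

variable [T2Space M] [SecondCountableTopology M] [Nonempty M]

/-- **`W₁` connected and ℚ-acyclic ⇒ `∂W₁` connected**: `H₁(W₁, ∂W₁; ℚ) = 0` (Lefschetz) makes
`H₀(∂W₁) → H₀(W₁) ≅ ℚ` injective, so all point classes of `∂W₁` agree, and `H₀` detects
components (`preconnectedSpace_of_pointClass_eq`). [folklore] -/
theorem connectedSpace_bd₁ [ConnectedSpace B.W₁] (h₁ : B.AcyclicLeft) : ConnectedSpace B.Bd₁ := by
  haveI := B.t2Space₁
  haveI : LocallyPathConnectedSpace B.W₁ :=
    ChartedSpace.locallyPathConnectedSpace (EuclideanHalfSpace 4) B.W₁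
  haveI : PathConnectedSpace B.W₁ := pathConnectedSpace_iff_connectedSpace.mpr ‹_›
  haveI : LocallyPathConnectedSpace B.Bd₁ :=
    ChartedSpace.locallyPathConnectedSpace (EuclideanSpace ℝ (Fin 3)) B.Bd₁
  haveI : Nonempty B.Bd₁ := let ⟨w, hw⟩ := B.boundaries_nonempty.1; ⟨⟨w, hw⟩⟩
  -- `H₀(∂W₁) → H₀(W₁)` is injective
  have hrel := B.isZero_relHomology₁ h₁ (p := 3) (q := 1) (by norm_num) rfl
  have hmono : Mono (singularHomology.map ℚ ℚ
      (⟨Subtype.val, continuous_subtype_val⟩ : C(B.Bd₁, B.W₁)) 0) :=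
    (relativeSingularHomology.exact_δ_map ℚ ℚ ((𝓡∂ 4).boundary B.W₁) 0).mono_g (hrel.eq_of_src _ _)
  have hinj := (ModuleCat.mono_iff_injective _).mp hmono
  haveI : PreconnectedSpace B.Bd₁ := preconnectedSpace_of_pointClass_eq fun z z' => hinj (by
    rw [map_pointClass, map_pointClass]
    exact pointClass_eq_of_pathConnectedSpace _ _)
  exact ⟨‹_›⟩

/-- **… ⇒ the seam is connected.** [folklore] -/
theorem isConnected_seam [ConnectedSpace B.W₁] (h₁ : B.AcyclicLeft) : IsConnected B.seam := by
  haveI := B.connectedSpace_bd₁ h₁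
  have : B.seam = range (B.e₁ ∘ Subtype.val : B.Bd₁ → M) := by
    rw [B.seam_eq_image₁, range_comp, Subtype.range_coe]
  rw [this]
  exact isConnected_range (B.continuous_e₁.comp continuous_subtype_val)

/-- **… ⇒ `W₂` is connected** (the seam is `∂W₂` up to the homeomorphism `seamHomeomorph`, and a
Stein domain with connected boundary is connected: tree
`SteinStructure.preconnectedSpace_of_isPreconnected_boundary`, maximum principle). [folklore] -/
theorem connectedSpace₂ [ConnectedSpace B.W₁] (h₁ : B.AcyclicLeft) : ConnectedSpace B.W₂ := by
  haveI := B.connectedSpace_bd₁ h₁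
  haveI := B.t2Space₂
  haveI : ConnectedSpace B.Bd₂ := B.seamHomeomorph.surjective.connectedSpace B.seamHomeomorph.continuous
  haveI : PreconnectedSpace B.W₂ := B.J₂.preconnectedSpace_of_isPreconnected_boundary
    (isPreconnected_iff_preconnectedSpace.mpr inferInstance)
  exact ⟨B.halves_nonempty.2⟩

/-- **Final form of §8: homology control AND connectedness on one half suffice.**  Over
`M ≃ₕ S⁴`, if `W₁` is connected and ℚ-acyclic then `W₂` is (connected and) ℚ-acyclic. [folklore] -/
theorem acyclicRight_of_acyclicLeft_of_homotopyEquiv' [IsManifold (𝓡 4) ∞ M] (e : M ≃ₕ 𝕊⁴)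
    [ConnectedSpace B.W₁] (h₁ : B.AcyclicLeft) : B.AcyclicRight := by
  haveI := B.connectedSpace₂ h₁
  exact B.acyclicRight_of_acyclicLeft_of_homotopyEquiv e h₁

end Witness

/-! ## §10 The seam is a full ℚ-homology 3-sphere, and the CONVERSE bookkeeping: over a
homotopy 4-sphere, connected halves + seam a ℚHS³ (degrees 1, 2) ⇒ both halves ℚ-acyclic -/

namespace Witness

open Literature.Topology.FourManifolds

variable {M : Type} [TopologicalSpace M] [ChartedSpace 𝔼4 M] (B : Witness M)
variable [T2Space M] [SecondCountableTopology M] [Nonempty M]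

/-- **`dim H₃(∂W₂; ℚ) = 1`** when `W₂` is connected and ℚ-acyclic: `H₄(W₂) = 0 → H₄(W₂, ∂W₂) →
H₃(∂W₂) → H₃(W₂) = 0` and `H₄(W₂, ∂W₂) ≅ H⁰(W₂; ℚ) ≅ ℚ` (Lefschetz).  With `isZero_homology_bd₂`
(degrees 1, 2) and `connectedSpace_bd₁`/`seamHomeomorph` (degree 0) the seam of an acyclic witness
with connected halves is a ℚ-homology 3-SPHERE, as the crux text asserts informally. [folklore] -/
theorem finrank_homology_bd₂_three [ConnectedSpace B.W₂] (h₂ : B.AcyclicRight) :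
    Module.finrank ℚ (singularHomology ℚ ℚ B.Bd₂ 3) = 1 := by
  haveI := B.t2Space₂
  -- `δ : H₄(W₂, ∂W₂) → H₃(∂W₂)` is an isomorphism
  have h4 : IsZero (singularHomology ℚ ℚ B.W₂ 4) := B.isZero_homology₂_of_four_le le_rfl
  haveI : Mono (relativeSingularHomology.δ ℚ ℚ B.W₂ ((𝓡∂ 4).boundary B.W₂) 3) :=
    (relativeSingularHomology.exact_ofAbsolute_δ ℚ ℚ ((𝓡∂ 4).boundary B.W₂) 3).mono_g
      (h4.eq_of_src _ _)
  haveI : Epi (relativeSingularHomology.δ ℚ ℚ B.W₂ ((𝓡∂ 4).boundary B.W₂) 3) :=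
    (relativeSingularHomology.exact_δ_map ℚ ℚ ((𝓡∂ 4).boundary B.W₂) 3).epi_f
      ((h₂ 3 (by norm_num)).eq_of_tgt _ _)
  haveI := isIso_of_mono_of_epi (relativeSingularHomology.δ ℚ ℚ B.W₂ ((𝓡∂ 4).boundary B.W₂) 3)
  have e1 : relativeSingularHomology ℚ ℚ B.W₂ ((𝓡∂ 4).boundary B.W₂) 4 ≃ₗ[ℚ]
      singularHomology ℚ ℚ B.Bd₂ 3 :=
    (asIso (relativeSingularHomology.δ ℚ ℚ B.W₂ ((𝓡∂ 4).boundary B.W₂) 3)).toLinearEquiv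
  rw [← e1.finrank_eq]
  -- Lefschetz: `H⁰(W₂; ℚ) ≃ H₄(W₂, ∂W₂; ℚ)`, and `dim H⁰ = 1`
  obtain ⟨zq, hbij⟩ := B.exists_lefschetz₂ (p := 0) (q := 2 + 1 + 1) rfl
  rw [← (LinearEquiv.ofBijective ((relCapProduct (M := ℚ) ((𝓡∂ (2 + 1 + 1)).boundary B.W₂)
    (show 0 + (2 + 1 + 1) = 2 + 1 + 1 from rfl)).flip zq) hbij).finrank_eq]
  rw [finrank_singularCohomology_eq_bettiNumber_of_field ℚ B.W₂ 0, bettiNumber]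
  haveI : LocallyPathConnectedSpace B.W₂ :=
    ChartedSpace.locallyPathConnectedSpace (EuclideanHalfSpace 4) B.W₂
  haveI : PathConnectedSpace B.W₂ := pathConnectedSpace_iff_connectedSpace.mpr ‹_›
  haveI := singularHomology.isIso_ε_of_pathConnectedSpace ℚ ℚ (X := B.W₂)
  rw [(asIso (singularHomology.ε ℚ ℚ B.W₂)).toLinearEquiv.finrank_eq]
  change Module.finrank ℚ (ULift.{0} ℚ) = 1
  rw [ULift.moduleEquiv.finrank_eq, Module.finrank_self]

variable [IsManifold (𝓡 4) ∞ M]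

/-- One rung of the converse ladder: if `Hₖ(∂W₁; ℚ) = 0`, `Hₖ₊₁(W₁; ℚ) = 0` and
`Hₖ(M; ℚ) = 0` then `Hₖ(W₂; ℚ) = 0` — `Hₖ₊₁(W₁) ↠ Hₖ₊₁(W₁, ∂W₁) ≅ Hₖ₊₁(M, e₂W₂) → Hₖ(e₂W₂) → Hₖ(M)`.
[folklore] -/
theorem isZero_homology₂_of_bd₁ {k : ℕ} (hΓ : IsZero (singularHomology ℚ ℚ B.Bd₁ k))
    (hW₁ : IsZero (singularHomology ℚ ℚ B.W₁ (k + 1))) (hM : IsZero (singularHomology ℚ ℚ M k)) :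
    IsZero (singularHomology ℚ ℚ B.W₂ k) := by
  refine IsZero.of_iso ?_ (singularHomology.mapIso ℚ ℚ B.emb₂.isEmbedding.toHomeomorph k)
  -- `H_{k+1}(W₁, ∂W₁) = 0`
  haveI : Epi (relativeSingularHomology.ofAbsolute ℚ ℚ B.W₁ ((𝓡∂ 4).boundary B.W₁) (k + 1)) :=
    (relativeSingularHomology.exact_ofAbsolute_δ ℚ ℚ ((𝓡∂ 4).boundary B.W₁) k).epi_f
      (hΓ.eq_of_tgt _ _)
  have hrel₁ : IsZero (relativeSingularHomology ℚ ℚ B.W₁ ((𝓡∂ 4).boundary B.W₁) (k + 1)) :=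
    hW₁.of_epi (relativeSingularHomology.ofAbsolute ℚ ℚ B.W₁ ((𝓡∂ 4).boundary B.W₁) (k + 1))
  -- `≅ H_{k+1}(M, e₂W₂)`
  haveI := B.swap.isIso_relMap₂ ℚ ℚ (k + 1)
  have hrel : IsZero (relativeSingularHomology ℚ ℚ M (range B.e₂) (k + 1)) :=
    hrel₁.of_iso (asIso (relativeSingularHomology.map ℚ ℚ B.swap.e₂CM
      B.swap.mapsTo_e₂_boundary (k + 1))).symm
  exact (relativeSingularHomology.exact_δ_map ℚ ℚ (range B.e₂) k).isZero_of_both_zeros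
    (hrel.eq_of_src _ _) (hM.eq_of_tgt _ _)

/-- **Converse bookkeeping.**  Over an `M` with the ℚ-homology of `S⁴` (degrees 1–4), a witness
with CONNECTED halves whose seam is a ℚ-homology sphere in degrees 1 and 2 has both halves
ℚ-acyclic: degree 3 by the dimension count of §8 (no acyclicity needed there), then degrees 2 and
1 alternately on the two halves by `isZero_homology₂_of_bd₁`, degrees `≥ 4` by the external
collar. [folklore] -/
theorem acyclic_of_seam [ConnectedSpace B.W₁] [ConnectedSpace B.W₂]
    (hΓ₁ : IsZero (singularHomology ℚ ℚ B.Bd₁ 1)) (hΓ₂ : IsZero (singularHomology ℚ ℚ B.Bd₁ 2))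
    (hM : ∀ k, 0 < k → k ≤ 3 → IsZero (singularHomology ℚ ℚ M k))
    (hM4 : Module.finrank ℚ (singularHomology ℚ ℚ M 4) = 1) : B.Acyclic := by
  -- the seam homology seen from `W₂`
  have hΓ₁' : IsZero (singularHomology ℚ ℚ B.Bd₂ 1) := hΓ₁.of_iso (singularHomology.mapIso ℚ ℚ B.seamHomeomorph 1).symm
  have hΓ₂' : IsZero (singularHomology ℚ ℚ B.Bd₂ 2) := hΓ₂.of_iso (singularHomology.mapIso ℚ ℚ B.seamHomeomorph 2).symm
  -- degree 3
  have h3₂ : IsZero (singularHomology ℚ ℚ B.W₂ 3) := B.isZero_homology₂_three (hM 3 (by norm_num) le_rfl) hM4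
  have h3₁ : IsZero (singularHomology ℚ ℚ B.W₁ 3) :=
    B.swap.isZero_homology₂_three (hM 3 (by norm_num) le_rfl) hM4
  -- degree 2, then degree 1
  have h2₂ : IsZero (singularHomology ℚ ℚ B.W₂ 2) := B.isZero_homology₂_of_bd₁ hΓ₂ h3₁ (hM 2 (by norm_num) (by norm_num))
  have h2₁ : IsZero (singularHomology ℚ ℚ B.W₁ 2) :=
    B.swap.isZero_homology₂_of_bd₁ hΓ₂' h3₂ (hM 2 (by norm_num) (by norm_num))
  have h1₂ : IsZero (singularHomology ℚ ℚ B.W₂ 1) := B.isZero_homology₂_of_bd₁ hΓ₁ h2₁ (hM 1 (by norm_num) (by norm_num))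
  have h1₁ : IsZero (singularHomology ℚ ℚ B.W₁ 1) :=
    B.swap.isZero_homology₂_of_bd₁ hΓ₁' h2₂ (hM 1 (by norm_num) (by norm_num))
  intro k hk
  rcases Nat.lt_or_ge k 4 with h | h
  · interval_cases k
    · exact ⟨h1₁, h1₂⟩
    · exact ⟨h2₁, h2₂⟩
    · exact ⟨h3₁, h3₂⟩
  · exact ⟨B.swap.isZero_homology₂_of_four_le h, B.isZero_homology₂_of_four_le h⟩

/-- **In the crux's setting**: over `M ≃ₕ S⁴`, a Stein bisection along a common contact seam
with connected halves is ℚ-acyclic iff its seam is a ℚ-homology sphere in degrees 1 and 2 — the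
informal gloss "(⇔ seam a connected ℚHS³)" of the crux text, machine-checked in both directions
(⇒: `isZero_homology_bd₁`; ⇐: `acyclic_of_seam`). [folklore] -/
theorem acyclic_iff_seam_of_homotopyEquiv (e : M ≃ₕ 𝕊⁴) [ConnectedSpace B.W₁] [ConnectedSpace B.W₂] :
    B.Acyclic ↔ IsZero (singularHomology ℚ ℚ B.Bd₁ 1) ∧ IsZero (singularHomology ℚ ℚ B.Bd₁ 2) :=
  ⟨fun hB => ⟨B.isZero_homology_bd₁ hB.left (by norm_num) (by norm_num),
      B.isZero_homology_bd₁ hB.left (by norm_num) (by norm_num)⟩,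
    fun h => B.acyclic_of_seam h.1 h.2
      (fun k hk hk3 => isZero_homology_of_homotopyEquiv_sphere e (by omega) (by omega))
      (finrank_homology_four_of_homotopyEquiv_sphere e)⟩

end Witness

/-! ## §10b Automatic connectedness of the halves of an ACYCLIC witness over a homotopy
4-sphere (so §8–§10 apply to the crux's witnesses with no extra hypothesis) -/

namespace Witness

open Literature.Topology.FourManifolds

variable {M : Type} [TopologicalSpace M] [ChartedSpace 𝔼4 M] (B : Witness M)
variable [T2Space M] [SecondCountableTopology M] [IsManifold (𝓡 4) ∞ M] [Nonempty M]

/-- **Both halves of an acyclic witness over a path-connected `M` are connected** (here: the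
first; the second by `swap`): `H₁(M, e₁W₁; ℚ) ≅ H₁(W₂, ∂W₂; ℚ) = 0` (Lefschetz, `H₃(W₂) = 0`)
makes `H₀(e₁W₁) → H₀(M) ≅ ℚ` injective, so all point classes of `e₁ W₁` agree and `H₀` detects
components (`preconnectedSpace_of_pointClass_eq`). [folklore] -/
theorem connectedSpace₁_of_acyclic [PathConnectedSpace M] (hB : B.Acyclic) : ConnectedSpace B.W₁ := by
  haveI := B.t2Space₁
  haveI : Nonempty B.W₁ := B.halves_nonempty.1
  -- `H₁(M, e₁W₁) = 0`
  haveI := B.isIso_relMap₂ ℚ ℚ 1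
  have hrel : IsZero (relativeSingularHomology ℚ ℚ M (range B.e₁) 1) :=
    (B.isZero_relHomology₂ hB.right (p := 3) (q := 1) (by norm_num) rfl).of_iso
      (asIso (relativeSingularHomology.map ℚ ℚ B.e₂CM B.mapsTo_e₂_boundary 1)).symm
  -- `H₀(e₁W₁) → H₀(M)` injective
  have hmono : Mono (singularHomology.map ℚ ℚ
      (⟨Subtype.val, continuous_subtype_val⟩ : C(↥(range B.e₁), M)) 0) :=
    (relativeSingularHomology.exact_δ_map ℚ ℚ (range B.e₁) 0).mono_g (hrel.eq_of_src _ _)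
  have hinj := (ModuleCat.mono_iff_injective _).mp hmono
  -- hence `e₁ W₁ ≃ₜ W₁` is preconnected
  haveI : LocallyPathConnectedSpace B.W₁ :=
    ChartedSpace.locallyPathConnectedSpace (EuclideanHalfSpace 4) B.W₁
  haveI : LocallyConnectedSpace ↥(range B.e₁) :=
    B.emb₁.isEmbedding.toHomeomorph.symm.locallyConnectedSpace
  haveI : PreconnectedSpace ↥(range B.e₁) := preconnectedSpace_of_pointClass_eq fun z z' => hinj (by
    rw [map_pointClass, map_pointClass]
    exact pointClass_eq_of_pathConnectedSpace _ _)
  haveI : PreconnectedSpace B.W₁ :=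
    ⟨by simpa using B.emb₁.isEmbedding.toHomeomorph.symm.isPreconnected_image.2 isPreconnected_univ⟩
  exact ⟨‹_›⟩

/-- The second half of an acyclic witness over a path-connected `M` is connected. [folklore] -/
theorem connectedSpace₂_of_acyclic [PathConnectedSpace M] (hB : B.Acyclic) : ConnectedSpace B.W₂ :=
  B.swap.connectedSpace₁_of_acyclic hB.swap

/-- **The seam of an acyclic witness over `M ≃ₕ S⁴` is a CONNECTED ℚ-homology 3-sphere, with
no connectedness hypothesis on the halves** (they are automatically connected,
`connectedSpace₁_of_acyclic`; `M` is path connected as a homotopy 4-sphere, tree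
`pathConnectedSpace_of_homotopyEquiv` / `pathConnectedSpace_sphere_four`): connected, `H₁ = H₂ = 0`,
`dim H₃ = 1` — the crux text's gloss "(⇔ seam a connected ℚHS³)", forward direction, verbatim.
[folklore] -/
theorem seam_connected_QHS_of_homotopyEquiv (e : M ≃ₕ 𝕊⁴) (hB : B.Acyclic) :
    IsConnected B.seam ∧ IsZero (singularHomology ℚ ℚ B.Bd₂ 1) ∧
      IsZero (singularHomology ℚ ℚ B.Bd₂ 2) ∧ Module.finrank ℚ (singularHomology ℚ ℚ B.Bd₂ 3) = 1 := by
  haveI : PathConnectedSpace 𝕊⁴ := pathConnectedSpace_sphere_four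
  haveI : PathConnectedSpace M := pathConnectedSpace_of_homotopyEquiv e
  haveI := B.connectedSpace₁_of_acyclic hB
  haveI := B.connectedSpace₂_of_acyclic hB
  exact ⟨B.isConnected_seam hB.left, B.isZero_homology_bd₂ hB.right (by norm_num) (by norm_num),
    B.isZero_homology_bd₂ hB.right (by norm_num) (by norm_num), B.finrank_homology_bd₂_three hB.right⟩

/-- **`acyclic_iff_seam_of_homotopyEquiv` without connectedness hypotheses in the forward
direction**: over `M ≃ₕ S⁴`, an acyclic witness has connected halves and a connected ℚHS³ seam;
conversely connected halves + seam ℚHS in degrees 1, 2 give acyclicity. [folklore] -/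
theorem acyclic_iff_connected_and_seam (e : M ≃ₕ 𝕊⁴) :
    B.Acyclic ↔ ConnectedSpace B.W₁ ∧ ConnectedSpace B.W₂ ∧
      IsZero (singularHomology ℚ ℚ B.Bd₁ 1) ∧ IsZero (singularHomology ℚ ℚ B.Bd₁ 2) := by
  haveI : PathConnectedSpace 𝕊⁴ := pathConnectedSpace_sphere_four
  haveI : PathConnectedSpace M := pathConnectedSpace_of_homotopyEquiv e
  constructor
  · intro hB
    exact ⟨B.connectedSpace₁_of_acyclic hB, B.connectedSpace₂_of_acyclic hB,
      B.isZero_homology_bd₁ hB.left (by norm_num) (by norm_num),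
      B.isZero_homology_bd₁ hB.left (by norm_num) (by norm_num)⟩
  · rintro ⟨h₁, h₂, hΓ₁, hΓ₂⟩
    exact (B.acyclic_iff_seam_of_homotopyEquiv e).2 ⟨hΓ₁, hΓ₂⟩

end Witness

/-! ## §11 TIGHTNESS and the kill criterion, formally: the ∃-body HOLDS at the round `S⁴`
(non-vacuity of the whole signature), witnesses transport along diffeomorphisms, hence
`SmoothPoincare4 → AcyclicBisectionExists` and `¬ AcyclicBisectionExists → ¬ SmoothPoincare4`
(a kill of this crux is literally an exotic 4-sphere) -/

section Tightness

open Literature.Topology.FourManifolds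
open Summit.SmoothPoincare4.SmoothPoincare4.Theorems.ContractibleTwistedDoubleStandard.Negative

/-- Local notation: the closed unit 4-ball. -/
local notation "𝔻⁴" => (Metric.closedBall (0 : EuclideanSpace ℝ (Fin 4)) 1)

/-- **TIGHTNESS / NON-VACUITY: the round `S⁴` has a ℚ-acyclic Stein bisection along a common
contact seam** — `S⁴ = 𝔻⁴ ∪_{S³} 𝔻⁴` by the two hemisphere embeddings, both halves the standard
Stein ball `(B⁴ ⊂ ℂ², J₀, |z|²)` (tree `steinStructureClosedBall`), the complex tangencies of the
two halves agreeing on the equator (the sibling crux's landed support theorem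
`crux_hypotheses_at_sphere`, `Theorems/ContractibleTwistedDoubleStandard/Negative/DoubleBisection.lean`),
and `𝔻⁴` contractible hence ℚ-acyclic.  So the crux's signature is satisfiable in the intended
way: it is neither junk-true nor junk-false at its basepoint. [folklore] -/
theorem hasAcyclicSteinBisection_sphere : HasAcyclicSteinBisection 𝕊⁴ := by
  obtain ⟨e₁, e₂, h1, h2, h3, h4, h5, h6⟩ := crux_hypotheses_at_sphere
  haveI : ContractibleSpace 𝔻⁴ := contractibleSpace_closedBall_four
  refine ⟨⟨𝔻⁴, 𝔻⁴, steinStructureClosedBall, steinStructureClosedBall, e₁, e₂, h1, h2, h3, h4, h5, h6⟩,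
    fun k hk => ⟨?_, ?_⟩⟩ <;>
    exact isZero_singularHomology_of_contractibleSpace ℚ ℚ (X := 𝔻⁴) (Nat.pos_iff_ne_zero.1 hk)

variable {M N : Type} [TopologicalSpace M] [ChartedSpace 𝔼4 M] [IsManifold (𝓡 4) ∞ M]
  [TopologicalSpace N] [ChartedSpace 𝔼4 N] [IsManifold (𝓡 4) ∞ N]

omit [IsManifold (𝓡 4) ∞ M] [IsManifold (𝓡 4) ∞ N] in
/-- Chain rule for pushed-forward subspaces: `d(Φ ∘ f)_x S = dΦ_{f x} (df_x S)`, with the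
base point `p = f x` abstracted (so that two maps hitting the same seam point can be compared
syntactically). [folklore] -/
theorem map_mfderiv_comp_diffeomorph (Φ : N ≃ₘ⟮𝓡 4, 𝓡 4⟯ M) {W : Type} [TopologicalSpace W]
    [ChartedSpace (EuclideanHalfSpace 4) W] {f : W → N} {x : W}
    (hf : MDifferentiableAt (𝓡∂ 4) (𝓡 4) f x) (S : Submodule ℝ 𝔼4) {p : N} (hp : f x = p) :
    Submodule.map (mfderiv (𝓡∂ 4) (𝓡 4) ((Φ : N → M) ∘ f) x).toLinearMap S =
      Submodule.map (mfderiv (𝓡 4) (𝓡 4) Φ p).toLinearMap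
        (Submodule.map (mfderiv (𝓡∂ 4) (𝓡 4) f x).toLinearMap S) := by
  subst hp
  have hΦ : MDifferentiableAt (𝓡 4) (𝓡 4) Φ (f x) := Φ.mdifferentiable (by simp) (f x)
  have h1 := congrArg (fun T : TangentSpace (𝓡∂ 4) x →L[ℝ] TangentSpace (𝓡 4) (Φ (f x)) =>
    Submodule.map T.toLinearMap S) (mfderiv_comp x hΦ hf)
  exact h1.trans (Submodule.map_comp _ _ _)

/-- **Witnesses transport along diffeomorphisms** `Φ : N ≅ M`: compose both embeddings with `Φ`;
the contact condition transports by the chain rule (`map_mfderiv_comp_diffeomorph`). [folklore] -/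
def Witness.transport (B : Witness N) (Φ : N ≃ₘ⟮𝓡 4, 𝓡 4⟯ M) : Witness M where
  W₁ := B.W₁
  W₂ := B.W₂
  J₁ := B.J₁
  J₂ := B.J₂
  e₁ := Φ ∘ B.e₁
  e₂ := Φ ∘ B.e₂
  emb₁ := B.emb₁.diffeomorph_comp Φ
  emb₂ := B.emb₂.diffeomorph_comp Φ
  cover := by
    rw [range_comp, range_comp, ← image_union, B.cover]
    exact image_univ_of_surjective Φ.surjective
  inter₁ := by
    have hinj : Function.Injective (Φ : N → M) := Φ.injective
    rw [range_comp, range_comp, ← image_inter hinj, B.inter₁, image_image]; rfl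
  inter₂ := by
    have hinj : Function.Injective (Φ : N → M) := Φ.injective
    rw [range_comp, range_comp, ← image_inter hinj, B.inter₂, image_image]; rfl
  contact w₁ w₂ h := by
    have h' : B.e₁ w₁ = B.e₂ w₂ := Φ.injective h
    have hd₁ : MDifferentiableAt (𝓡∂ 4) (𝓡 4) B.e₁ w₁ := B.emb₁.contMDiff.mdifferentiableAt (by simp)
    have hd₂ : MDifferentiableAt (𝓡∂ 4) (𝓡 4) B.e₂ w₂ := B.emb₂.contMDiff.mdifferentiableAt (by simp)
    rw [map_mfderiv_comp_diffeomorph Φ hd₁ _ h', map_mfderiv_comp_diffeomorph Φ hd₂ _ rfl]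
    exact congrArg _ (B.contact w₁ w₂ h')

/-- Transport preserves acyclicity (the halves do not change). [folklore] -/
theorem Witness.transport_acyclic {B : Witness N} (hB : B.Acyclic) (Φ : N ≃ₘ⟮𝓡 4, 𝓡 4⟯ M) :
    (B.transport Φ).Acyclic := hB

/-- `HasAcyclicSteinBisection` is a diffeomorphism invariant. [folklore] -/
theorem hasAcyclicSteinBisection_of_diffeomorph (Φ : N ≃ₘ⟮𝓡 4, 𝓡 4⟯ M)
    (h : HasAcyclicSteinBisection N) : HasAcyclicSteinBisection M := by
  obtain ⟨B, hB⟩ := h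
  exact ⟨B.transport Φ, Witness.transport_acyclic hB Φ⟩

end Tightness

/-- **The crux is implied by the summit**: `SmoothPoincare4 → AcyclicBisectionExists` (transport
the `S⁴` witness along the diffeomorphism `M ≅ S⁴`).  With the route's deciding theorem
(`AcyclicBisectionExists → AcyclicBisectionRigidity → SmoothPoincare4`) and the sibling disprover's
`iff_spc4_of_exists`, the pair of cruxes is exactly as strong as SPC4. [folklore] -/
theorem acyclicBisectionExists_of_spc4 (h : _root_.SmoothPoincare4) : AcyclicBisectionExists := by
  rw [acyclicBisectionExists_iff]
  intro M _ _ _ _ _ e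
  obtain ⟨Φ⟩ := h M ‹_› ‹_› e
  exact hasAcyclicSteinBisection_of_diffeomorph Φ.symm hasAcyclicSteinBisection_sphere

/-- **KILL CRITERION, formally: a refutation of this crux is an exotic 4-sphere.** [folklore] -/
theorem not_spc4_of_not_acyclicBisectionExists (h : ¬ AcyclicBisectionExists) : ¬ _root_.SmoothPoincare4 :=
  fun hs => h (acyclicBisectionExists_of_spc4 hs)

/-- The exotic sphere extracted from a kill: some smooth `M ≃ₕ S⁴` with NO ℚ-acyclic Stein
bisection along a common contact seam — in particular not diffeomorphic to `S⁴`. [folklore] -/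
theorem exotic_of_not_acyclicBisectionExists (h : ¬ AcyclicBisectionExists) :
    ∃ (M : Type) (_ : TopologicalSpace M) (_ : T2Space M) (_ : SecondCountableTopology M)
      (_ : ChartedSpace 𝔼4 M) (_ : IsManifold (𝓡 4) ∞ M),
      Nonempty (M ≃ₕ 𝕊⁴) ∧ ¬ HasAcyclicSteinBisection M ∧ IsEmpty (M ≃ₘ⟮𝓡 4, 𝓡 4⟯ 𝕊⁴) := by
  rw [acyclicBisectionExists_iff] at h
  simp only [not_forall] at h
  obtain ⟨M, _, _, _, _, _, e, hM⟩ := h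
  refine ⟨M, ‹_›, ‹_›, ‹_›, ‹_›, ‹_›, ⟨e⟩, hM, ⟨fun Φ => hM ?_⟩⟩
  exact hasAcyclicSteinBisection_of_diffeomorph Φ.symm hasAcyclicSteinBisection_sphere

/-! ## §7 The near-miss of gen 1, now CLOSED: the homotopy-sphere hypothesis cannot be weakened
to "closed simply connected" -/

/-- The crux with `M ≃ₕ S⁴` weakened to "`M` closed (compact, connected, nonempty) and simply
connected". [folklore] -/
def AcyclicBisectionExistsForSimplyConnectedClosed : Prop :=
  ∀ (M : Type) [TopologicalSpace M] [T2Space M] [SecondCountableTopology M] [CompactSpace M]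
    [ConnectedSpace M] [SimplyConnectedSpace M] [ChartedSpace 𝔼4 M] [IsManifold (𝓡 4) ∞ M],
    HasAcyclicSteinBisection M

open Literature.Topology.FourManifolds in
/-- **`ℂℙ²` has no ℚ-acyclic Stein bisection** (along a common contact seam or not — the contact
condition is not used): `H₂(ℂℙ²; ℚ) ≅ ℚ ≠ 0` (tree `ComplexProjectivePlane.singularHomologyTwoIso`)
against `Witness.isZero_homology_of_acyclic`.  Hence the homotopy-sphere hypothesis of the crux is
used at least through `b₂(M) = 0` (and `b₁ = b₃ = 0`), not merely through compactness or simple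
connectivity. [folklore] -/
theorem not_hasAcyclicSteinBisection_complexProjectivePlane :
    ¬ HasAcyclicSteinBisection ComplexProjectivePlane := by
  rintro ⟨B, hB⟩
  have h2 := B.isZero_homology_of_acyclic hB (k := 2) (by norm_num) (by norm_num)
  have hQ : IsZero (ModuleCat.of ℚ ℚ) :=
    h2.of_iso (ComplexProjectivePlane.singularHomologyTwoIso ℚ ℚ).symm
  haveI := ModuleCat.subsingleton_of_isZero hQ
  exact zero_ne_one (Subsingleton.elim (0 : ℚ) 1)

/-- **Refuted weakening** (gen-1 near-miss `acyclicBisectionExists_false_for_closed`, closed):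
NOT every closed simply connected smooth 4-manifold admits a ℚ-acyclic Stein bisection along a
common contact seam — witness `ℂℙ²`. [folklore] -/
theorem not_acyclicBisectionExistsForSimplyConnectedClosed :
    ¬ AcyclicBisectionExistsForSimplyConnectedClosed := fun h =>
  not_hasAcyclicSteinBisection_complexProjectivePlane (h Literature.Topology.FourManifolds.ComplexProjectivePlane)

/-! ## §12 (gen 3) An acyclic witness forces `b₄(M) = 1`: the ∃-body pins `M` to be a rational
homology 4-SPHERE in every degree (closed connected NON-orientable `M` are excluded too) -/

namespace Witness

open Literature.Topology.FourManifolds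

variable {M : Type} [TopologicalSpace M] [ChartedSpace 𝔼4 M] (B : Witness M)
variable [T2Space M] [SecondCountableTopology M] [IsManifold (𝓡 4) ∞ M] [Nonempty M]

/-- **An acyclic right half forces `b₄(M) = 1`** (both halves connected): in
`H₄(e₂W₂) → H₄(M) → H₄(M, e₂W₂) → H₃(e₂W₂)` the outer groups vanish (`W₂` connected with
nonempty boundary has no `H₄`; `H₃(W₂; ℚ) = 0` by acyclicity), so
`H₄(M; ℚ) ≅ H₄(M, e₂W₂; ℚ) ≅ H₄(W₁, ∂W₁; ℚ) ≅ H⁰(W₁; ℚ) ≅ ℚ` (`finrank_relHomology_four`).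
[folklore] -/
theorem finrank_homology_four_of_acyclicRight [ConnectedSpace B.W₁] [ConnectedSpace B.W₂]
    (h₂ : B.AcyclicRight) : Module.finrank ℚ (singularHomology ℚ ℚ M 4) = 1 := by
  have eA : B.W₂ ≃ₜ ↥(range B.e₂) := B.emb₂.isEmbedding.toHomeomorph
  have hA4 : IsZero (singularHomology ℚ ℚ ↥(range B.e₂) 4) :=
    (B.isZero_homology₂_of_four_le le_rfl).of_iso (singularHomology.mapIso ℚ ℚ eA 4).symm
  have hA3 : IsZero (singularHomology ℚ ℚ ↥(range B.e₂) 3) :=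
    (h₂ 3 (by norm_num)).of_iso (singularHomology.mapIso ℚ ℚ eA 3).symm
  have hmono : Mono (relativeSingularHomology.ofAbsolute ℚ ℚ M (range B.e₂) 4) :=
    (relativeSingularHomology.exact_map_ofAbsolute ℚ ℚ (range B.e₂) 4).mono_g (hA4.eq_of_src _ _)
  have hepi : Epi (relativeSingularHomology.ofAbsolute ℚ ℚ M (range B.e₂) 4) :=
    (relativeSingularHomology.exact_ofAbsolute_δ ℚ ℚ (range B.e₂) 3).epi_f (hA3.eq_of_tgt _ _)
  haveI := isIso_of_mono_of_epi (relativeSingularHomology.ofAbsolute ℚ ℚ M (range B.e₂) 4)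
  rw [(asIso (relativeSingularHomology.ofAbsolute ℚ ℚ M (range B.e₂) 4)).toLinearEquiv.finrank_eq]
  exact B.finrank_relHomology_four

/-- **`b₄(M) = 1` for every path-connected `M` carrying an acyclic witness** (the halves are
automatically connected, §10b). [folklore] -/
theorem finrank_homology_four_of_acyclic [PathConnectedSpace M] (hB : B.Acyclic) :
    Module.finrank ℚ (singularHomology ℚ ℚ M 4) = 1 := by
  haveI := B.connectedSpace₁_of_acyclic hB
  haveI := B.connectedSpace₂_of_acyclic hB
  exact B.finrank_homology_four_of_acyclicRight hB.right

/-- **The full homological content of the ∃-body: a path-connected `M` with a ℚ-acyclic Stein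
bisection is a rational homology 4-sphere** — `H₁ = H₂ = H₃ = 0` (§6) AND `dim H₄ = 1` (§12).
So the hypothesis `M ≃ₕ S⁴` of the crux is consumed (homologically) exactly through "`M` is a
ℚHS⁴": `b₁ = b₂ = b₃ = 0` (the `ℂℙ²` refutation, §7) and `b₄ = 1` — the latter excludes every
closed connected NON-orientable 4-manifold (`H₄(M; ℤ) = 0`, Hatcher 3.26(b), tree
`isZero_singularHomology_top_of_not_isOrientableOver_int_holds`, hence `H₄(M; ℚ) = 0` by UCT),
e.g. `ℝℙ⁴`, whose rational homology vanishes in degrees `1, 2, 3` like a homotopy sphere's.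
What the ∃-body does NOT see: `π₁` (on paper the doubles `D(B_{p,q})` of the Stein rational balls
are ℚHS⁴'s with `π₁ = ℤ/p` carrying acyclic Stein bisections, cf. §13). [folklore] -/
theorem rationalHomologySphere_of_acyclic [PathConnectedSpace M] (hB : B.Acyclic) :
    (∀ k, 0 < k → k ≤ 3 → IsZero (singularHomology ℚ ℚ M k)) ∧
      Module.finrank ℚ (singularHomology ℚ ℚ M 4) = 1 :=
  ⟨fun _ hk hk3 => B.isZero_homology_of_acyclic hB hk hk3, B.finrank_homology_four_of_acyclic hB⟩

/-- **No ℚ-acyclic Stein bisection on a path-connected `M` with `b₄(M) ≠ 1`** (e.g. a closed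
connected non-orientable `M`, where `H₄(M; ℚ) = 0`; or a non-compact `M`, §3). [folklore] -/
theorem not_acyclic_of_finrank_homology_four_ne_one [PathConnectedSpace M]
    (hM : Module.finrank ℚ (singularHomology ℚ ℚ M 4) ≠ 1) : ¬ B.Acyclic := fun hB =>
  hM (B.finrank_homology_four_of_acyclic hB)

end Witness

/-- `HasAcyclicSteinBisection M` forces `b₄(M) = 1` (path-connected `M`). [folklore] -/
theorem finrank_homology_four_of_hasAcyclicSteinBisection {M : Type} [TopologicalSpace M]
    [ChartedSpace 𝔼4 M] [T2Space M] [SecondCountableTopology M] [IsManifold (𝓡 4) ∞ M]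
    [Nonempty M] [PathConnectedSpace M] (h : HasAcyclicSteinBisection M) :
    Module.finrank ℚ (singularHomology ℚ ℚ M 4) = 1 := by
  obtain ⟨B, hB⟩ := h
  exact B.finrank_homology_four_of_acyclic hB

/-! ## §13 (gen 3) DOUBLES: the ∃-body HOLDS on every double `D(W) = W ∪_id W` of a ℚ-acyclic
compact Stein domain — the `ψ = id` sector of the existence crux is free, and (on paper) the
∃-body holds on non-simply-connected ℚHS⁴'s, so it does not detect homotopy spheres -/

section Doubles

open Literature.Topology.FourManifolds
open Summit.SmoothPoincare4.SmoothPoincare4.Theorems.ContractibleTwistedDoubleStandard.Negative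

variable {W : Type} [TopologicalSpace W] [ChartedSpace (EuclideanHalfSpace 4) W]
  [IsManifold (𝓡∂ 4) ∞ W] [CompactSpace W]
  {P : Type} [TopologicalSpace P] [ChartedSpace 𝔼4 P]

/-- **Every double `D(W) = W ∪_id W` of a compact Stein domain is a witness** (both halves
`(W, J)`, the two canonical embeddings; the complex tangencies agree on the seam because the two
embeddings agree along `∂W` — the sibling crux's landed `steinBisection_of_glue`,
`Theorems/ContractibleTwistedDoubleStandard/Negative/DoubleBisection.lean`). [folklore] -/
def Witness.ofIsDouble (b : BoundaryData (𝓡∂ 4) W (𝓡 3)) (S : SteinStructure W)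
    (h : IsDouble b (𝓡 4) P) : Witness P :=
  let jA := h.choose
  let jB := h.choose_spec.choose
  have H := steinBisection_of_glue b S h.choose_spec.choose_spec.1 h.choose_spec.choose_spec.2.1
    h.choose_spec.choose_spec.2.2.1 h.choose_spec.choose_spec.2.2.2
  { W₁ := W, W₂ := W, J₁ := S, J₂ := S, e₁ := jA, e₂ := jB,
    emb₁ := H.1, emb₂ := H.2.1, cover := H.2.2.1, inter₁ := H.2.2.2.1, inter₂ := H.2.2.2.2.1,
    contact := H.2.2.2.2.2 }

/-- **The ∃-body of the crux HOLDS on every double of a ℚ-acyclic compact Stein domain**: if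
`H_k(W; ℚ) = 0` for `k > 0` and `P = D(W)` then `HasAcyclicSteinBisection P`.  Consequences:
(i) the `ψ = id` sector of the EXISTENCE crux is free — every presentation homotopy sphere
`D(C) = ∂(C × I)` (`C` a contractible compact Stein domain: Mazur manifolds, Stein corks, the
Akbulut–Matveyev pieces) satisfies `AcyclicBisectionExists` at `M = D(C)` WITHOUT deciding
`D(C) ≅ S⁴` (Andrews–Curtis adjacent; that decision is the RIGIDITY crux's `double_standard_of_crux`);
(ii) ON PAPER the doubles `D(B_{p,q})` of the Stein rational homology balls are ℚ-homology
4-spheres with `π₁ = ℤ/p ≠ 1` carrying acyclic Stein bisections: `HasAcyclicSteinBisection M`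
does NOT imply `M ≃ₕ S⁴` — the class cut out by the ∃-body is {some ℚHS⁴'s} ⊋ {homotopy spheres
with the property}, and the rigidity crux genuinely needs its hypothesis `M ≃ₕ S⁴`. [folklore] -/
theorem hasAcyclicSteinBisection_of_isDouble (b : BoundaryData (𝓡∂ 4) W (𝓡 3)) (S : SteinStructure W)
    (hW : ∀ k, 0 < k → IsZero (singularHomology ℚ ℚ W k)) (h : IsDouble b (𝓡 4) P) :
    HasAcyclicSteinBisection P :=
  ⟨Witness.ofIsDouble b S h, fun k hk => ⟨hW k hk, hW k hk⟩⟩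

/-- **Existence form**: every ℚ-acyclic compact Hausdorff Stein domain `W` HAS a double — a closed smooth 4-manifold `P = W ∪_id W` (tree `exists_isBoundaryGluing_holds`
at `φ = id`, Bröcker–Jänich (13.11)) — and that double carries a ℚ-acyclic Stein bisection along a
common contact seam.  With `hasAcyclicSteinBisection_of_diffeomorph` (§11) and gluing uniqueness
(`nonempty_diffeomorph_of_isBoundaryGluing_holds`) the same holds for ANY smooth manifold that is
a double of `W`. [folklore] -/
theorem exists_double_hasAcyclicSteinBisection [T2Space W]
    (S : SteinStructure W) (hW : ∀ k, 0 < k → IsZero (singularHomology ℚ ℚ W k)) :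
    ∃ (P : Type) (_ : TopologicalSpace P) (_ : T2Space P) (_ : SecondCountableTopology P)
      (_ : CompactSpace P) (_ : ChartedSpace 𝔼4 P) (_ : IsManifold (𝓡 4) ∞ P),
      IsDouble (BoundaryManifold.boundaryData 3 W) (𝓡 4) P ∧ HasAcyclicSteinBisection P := by
  obtain ⟨P, _, _, _, _, _, _, hP⟩ :=
    exists_isBoundaryGluing_holds (bM := BoundaryManifold.boundaryData 3 W)
      (bN := BoundaryManifold.boundaryData 3 W) (Diffeomorph.refl (𝓡 3) _ ∞)
  have hD : IsDouble (BoundaryManifold.boundaryData 3 W) (𝓡 4) P := by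
    have e : (⇑(Diffeomorph.refl (𝓡 3) (BoundaryManifold.boundaryData 3 W).carrier ∞) :
        (BoundaryManifold.boundaryData 3 W).carrier → (BoundaryManifold.boundaryData 3 W).carrier) = id :=
      rfl
    rw [e] at hP
    exact hP
  exact ⟨P, ‹_›, ‹_›, ‹_›, ‹_›, ‹_›, ‹_›, hD,
    hasAcyclicSteinBisection_of_isDouble _ S hW hD⟩

end Doubles

/-! ## §14 (gen 3) TARGETS — the registered skeleton `Lines/braided-branch-locus.lean`
(and the two sibling skeletons): no stub refuted; `stub_hurwitzTransitive` decided TRUE on all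
small parameters and proved on paper; formal WLOG-sorted reduction for the lead

No stub of the three candidate lines (`braided-branch-locus`, `achiral-swap`, `modp-braid-orbits`;
no `PICKED.md` yet, payload `stuck_stubs = []`) is refuted.  The one stub decidable by finite
computation, braided-branch-locus **Stub 3** `stub_hurwitzTransitive : HurwitzTransitivity`
("pure combinatorics, provable now"), was attacked as a potential kill and SURVIVES:

**Exact decision procedure** (`hurwitz/hurwitz_transitivity.py` + `orbitcount.py`, attached as
item evidence; kit jobs `j008817` (`m = 4, n = 10`; `m = 6, n = 8`) and `j008818`
(`m = 5, n ∈ {8, 9}`) queued).  Signed Hurwitz moves = the braid group `B_n` acting on pairs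
`(T, s)` (unsigned tuple of transpositions, sign word), the sign word being permuted through
`B_n → S_n`.  For the unsigned orbit `X = B_n · T₀` the image `H ≤ S_n` of `Stab(T₀)` is generated
by the Schreier elements of a BFS spanning tree of `X`; signed orbits over `X` with `p` positive
letters ↔ `H`-orbits on `p`-subsets of positions, and `HurwitzTransitivity` holds on `(X, p)` as
soon as `H` is transitive on `p`-subsets (a connected letter graph contains a spanning tree;
otherwise an exhaustive signed BFS decides).  COMPLETENESS is certified WITHOUT the
Clebsch–Hurwitz–Kluitmann theorem: `|X|` is compared with the exact number `N(π₀)` of connected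
`n`-tuples with product `π₀` (character-free DP over `S_m` for all factorisations, then the
exponential formula over set partitions of the cycles of `π₀` for the connected ones; validated
against brute force for `m ≤ 5`), and `|X| = N(π₀)` held in every case (single orbit certified).
RESULT (0 counterexamples): for ALL `(m, n)` with `m ≤ 7, n ≤ 7`, and for `m ≤ 4, n ≤ 9`,
`m = 5, n ≤ 7` (orbits up to `|X| = 839 680`; every admissible product class and every
`p ≥ m - 1`), `H` is transitive on `p`-subsets, so the stub HOLDS there (the ideator's kit j005725
had `m ≤ 4, n ≤ 6` by brute force).

**Paper proof for all `(m, n)`**, modulo the Clebsch–Hurwitz–Kluitmann theorem (connected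
transposition tuples in `Sym(C)` with equal length and product are Hurwitz-equivalent; Kluitmann
1988 — used only blockwise).  By `exists_sorted`, `closure_letters_eq_of_hurwitz`,
`allTranspositions_of_hurwitz` below (sorry-free; packaged as `hurwitzTransitivity_of_sorted`)
WLOG `l = P ++ N` with `P` the positive letters.  Induct on the number `Φ` of connected components
of the graph of `P` on `Fin m` (`Φ = 1` is the goal).  If `Φ ≥ 2`: `#P ≥ m - 1 > m - Φ` gives a
component `C` whose block has a redundant edge (`k_C ≥ |C|` letters), and connectivity of the
whole letter graph gives a NEGATIVE bridge `x = (u v) ∈ N`, `u ∈ C`, `v ∉ C` (positive edges stay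
inside components).  Inside `N` move `x` to the front unchanged (`(z, x) ↦ (x, x⁻¹ z x)`); inside
`P` put the block `B` of `C` last (commuting letters swap without changing) and use Kluitmann on
`B` to reach `B = F ++ [(u z), (u z)]` with `F ∪ {(u z)}` connected on `C` (possible exactly when
`k_C ≥ |C|`: if `π_C` is one `|C|`-cycle, `k_C ≥ |C| + 1` by parity, take a path factorisation
padded by doubled edges and any `z`; if `π_C` has `c ≥ 2` cycles, factor the cycle of `u` and the
remaining cycles ∋ `z` separately, total length `|C| + c - 4 ≤ k_C - 2`).  The single move
`((u z)⁺, (u v)⁻) ↦ ((u v)⁻, ((u v)(u z)(u v))⁺) = ((u v)⁻, (v z)⁺)` then replaces ONE copy of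
`(u z)` by `(v z)`: `C` stays connected through `F ∪ {(u z)}` and is joined to the component of
`v`, so `Φ` drops; re-sort (`exists_sorted` keeps positive letters) and conclude by induction.
So Stub 3 is TRUE; its honest formal size is Kluitmann's normal-form theorem for the blocks
(M → L) unless the lead finds a local rerouting argument.

Other stubs, on paper (no finite handle): braided-branch-locus Stub 1 (`Q_or`), Stub 2, Stub 6 and
the geometric stubs of `achiral-swap` / `modp-braid-orbits` hold at `M = S⁴` (hemispheres; `d = 2`
over the unknotted `S²`) and are implied by SPC4 like the crux itself — unrefutable here;
`stub_sortBiSpan` (modp Stub 4) is TRUE as stated (its docstring proof checks in every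
characteristic: `T_P - 1` is injective by the telescoping identity, the basis property and
non-degeneracy of `stdSymp`; `T_P T_N = 1` makes `T_N - 1` injective hence onto, and
`range (T_N - 1) ⊆ span N`); `stub_modpOrbit` quantifies `∃ p₀`, so no finite computation can refute
it (triage: `g = 1`, `p ≤ 7`: one orbit); Stub 6's regular-value claim over the equator re-derived
(`d(t ∘ f) = ‖(w,t)‖ · d(heightS ∘ b) ≠ 0` at seam points: `b` is a local diffeomorphism off `C` and
no branch value lies on the equator) — consistent.  The lemmas below are positive helpers for the
lead, stated over VERBATIM copies of the skeleton's `HurwitzStep` / `GenTransitive` /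
`HurwitzTransitivity` (transfer by copy-paste). -/

namespace Targets

variable {G : Type*} [Group G]

/-- verbatim copy of `BraidedBranchLocus.HurwitzStep` (skeleton `Lines/braided-branch-locus.lean`) -/
def HurwitzStep (l l' : List (G × Bool)) : Prop :=
  ∃ (pre suf : List (G × Bool)) (a b : G × Bool),
    l = pre ++ a :: b :: suf ∧
    (l' = pre ++ (a.1 * b.1 * a.1⁻¹, b.2) :: a :: suf ∨
     l' = pre ++ b :: (b.1⁻¹ * a.1 * b.1, a.2) :: suf)

theorem HurwitzStep.append_left (p : List (G × Bool)) {l l' : List (G × Bool)} (h : HurwitzStep l l') :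
    HurwitzStep (p ++ l) (p ++ l') := by
  obtain ⟨pre, suf, a, b, rfl, h⟩ := h
  refine ⟨p ++ pre, suf, a, b, by simp, ?_⟩
  rcases h with rfl | rfl
  · exact Or.inl (by simp)
  · exact Or.inr (by simp)

theorem HurwitzStep.append_right (s : List (G × Bool)) {l l' : List (G × Bool)} (h : HurwitzStep l l') :
    HurwitzStep (l ++ s) (l' ++ s) := by
  obtain ⟨pre, suf, a, b, rfl, h⟩ := h
  refine ⟨pre, suf ++ s, a, b, by simp, ?_⟩
  rcases h with rfl | rfl
  · exact Or.inl (by simp)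
  · exact Or.inr (by simp)

theorem hurwitz_append_left (p : List (G × Bool)) {l l' : List (G × Bool)}
    (h : Relation.ReflTransGen HurwitzStep l l') :
    Relation.ReflTransGen HurwitzStep (p ++ l) (p ++ l') :=
  Relation.ReflTransGen.lift (r := HurwitzStep) (p := HurwitzStep) (fun t => p ++ t)
    (fun _ _ (hab : HurwitzStep _ _) => hab.append_left p) l l' h

theorem hurwitz_append_right (s : List (G × Bool)) {l l' : List (G × Bool)}
    (h : Relation.ReflTransGen HurwitzStep l l') :
    Relation.ReflTransGen HurwitzStep (l ++ s) (l' ++ s) :=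
  Relation.ReflTransGen.lift (r := HurwitzStep) (p := HurwitzStep) (fun t => t ++ s)
    (fun _ _ (hab : HurwitzStep _ _) => hab.append_right s) l l' h

/-- One letter travels to the right through a list by inverse Hurwitz moves `(a, b) ↦ (b, b⁻¹ab)`,
leaving that list unchanged and keeping its own sign (its group element gets conjugated). -/
theorem hurwitz_move_right (x : G × Bool) (P : List (G × Bool)) :
    ∃ x' : G × Bool, x'.2 = x.2 ∧ Relation.ReflTransGen HurwitzStep (x :: P) (P ++ [x']) := by
  induction P generalizing x with
  | nil => exact ⟨x, rfl, by simpa using (Relation.ReflTransGen.refl : Relation.ReflTransGen HurwitzStep [x] [x])⟩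
  | cons p P ih =>
    obtain ⟨x', hx', h⟩ := ih (p.1⁻¹ * x.1 * p.1, x.2)
    refine ⟨x', hx', ?_⟩
    have step : HurwitzStep (x :: p :: P) (p :: (p.1⁻¹ * x.1 * p.1, x.2) :: P) :=
      ⟨[], P, x, p, by simp, Or.inr (by simp)⟩
    exact (Relation.ReflTransGen.single step).trans (by simpa using hurwitz_append_left [p] h)

/-- **Sorting with unchanged positive letters**: every signed list is Hurwitz-equivalent to
`(its positive letters, unchanged and in order) ++ (negative letters)`. -/
theorem exists_sorted (l : List (G × Bool)) :
    ∃ N : List (G × Bool), (∀ x ∈ N, x.2 = false) ∧ N.length = (l.filter fun x => !x.2).length ∧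
      Relation.ReflTransGen HurwitzStep l (l.filter (fun x => x.2) ++ N) := by
  induction l with
  | nil => exact ⟨[], by simp, by simp, by simpa using (Relation.ReflTransGen.refl : Relation.ReflTransGen HurwitzStep [] [])⟩
  | cons y l ih =>
    obtain ⟨N, hN, hlen, h⟩ := ih
    have h1 : Relation.ReflTransGen HurwitzStep (y :: l) (y :: (l.filter (fun x => x.2) ++ N)) := by
      simpa using hurwitz_append_left [y] h
    cases hy : y.2 with
    | true =>
      refine ⟨N, hN, by simp [hy, hlen], ?_⟩
      simpa [List.filter_cons, hy] using h1
    | false =>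
      obtain ⟨y', hy', h2⟩ := hurwitz_move_right y (l.filter fun x => x.2)
      refine ⟨y' :: N, ?_, by simp [hy, hlen], ?_⟩
      · intro x hx
        rcases List.mem_cons.1 hx with rfl | hx
        · rw [hy', hy]
        · exact hN x hx
      · have h3 := hurwitz_append_right N h2
        simp only [List.cons_append, List.append_assoc] at h3
        simpa [List.filter_cons, hy] using h1.trans h3

/-- The letters (group elements) of a signed list — literally the set `{g | ∃ x ∈ l, x.1 = g}` of
`HurwitzTransitivity`. -/
def letters (l : List (G × Bool)) : Set G := {g | ∃ x ∈ l, x.1 = g}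

omit [Group G] in
theorem mem_letters {l : List (G × Bool)} {x : G × Bool} (hx : x ∈ l) : x.1 ∈ letters l := ⟨x, hx, rfl⟩

/-- A Hurwitz move does not change the subgroup generated by the letters. -/
theorem HurwitzStep.closure_letters_eq {l l' : List (G × Bool)} (h : HurwitzStep l l') :
    Subgroup.closure (letters l') = Subgroup.closure (letters l) := by
  obtain ⟨pre, suf, a, b, rfl, h⟩ := h
  have ha : a.1 ∈ Subgroup.closure (letters (pre ++ a :: b :: suf)) :=
    Subgroup.subset_closure (mem_letters (by simp))
  have hb : b.1 ∈ Subgroup.closure (letters (pre ++ a :: b :: suf)) :=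
    Subgroup.subset_closure (mem_letters (by simp))
  apply le_antisymm
  · rw [Subgroup.closure_le]
    rintro g ⟨x, hx, rfl⟩
    rcases h with rfl | rfl
    · simp only [List.mem_append, List.mem_cons] at hx
      rcases hx with hx | rfl | rfl | hx
      · exact Subgroup.subset_closure (mem_letters (by simp [hx]))
      · exact Subgroup.mul_mem _ (Subgroup.mul_mem _ ha hb) (Subgroup.inv_mem _ ha)
      · exact ha
      · exact Subgroup.subset_closure (mem_letters (by simp [hx]))
    · simp only [List.mem_append, List.mem_cons] at hx
      rcases hx with hx | rfl | rfl | hx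
      · exact Subgroup.subset_closure (mem_letters (by simp [hx]))
      · exact hb
      · exact Subgroup.mul_mem _ (Subgroup.mul_mem _ (Subgroup.inv_mem _ hb) ha) hb
      · exact Subgroup.subset_closure (mem_letters (by simp [hx]))
  · rw [Subgroup.closure_le]
    rintro g ⟨x, hx, rfl⟩
    simp only [List.mem_append, List.mem_cons] at hx
    rcases h with rfl | rfl
    · have ha' : a.1 ∈ Subgroup.closure (letters (pre ++ (a.1 * b.1 * a.1⁻¹, b.2) :: a :: suf)) :=
        Subgroup.subset_closure (mem_letters (by simp))
      have hc : a.1 * b.1 * a.1⁻¹ ∈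
          Subgroup.closure (letters (pre ++ (a.1 * b.1 * a.1⁻¹, b.2) :: a :: suf)) :=
        Subgroup.subset_closure (mem_letters (x := (a.1 * b.1 * a.1⁻¹, b.2)) (by simp))
      rcases hx with hx | rfl | rfl | hx
      · exact Subgroup.subset_closure (mem_letters (by simp [hx]))
      · exact ha'
      · have key := Subgroup.mul_mem _ (Subgroup.mul_mem _ (Subgroup.inv_mem _ ha') hc) ha'
        have e' : a.1⁻¹ * (a.1 * x.1 * a.1⁻¹) * a.1 = x.1 := by group
        rw [e'] at key
        exact key
      · exact Subgroup.subset_closure (mem_letters (by simp [hx]))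
    · have hb' : b.1 ∈ Subgroup.closure (letters (pre ++ b :: (b.1⁻¹ * a.1 * b.1, a.2) :: suf)) :=
        Subgroup.subset_closure (mem_letters (by simp))
      have hc : b.1⁻¹ * a.1 * b.1 ∈
          Subgroup.closure (letters (pre ++ b :: (b.1⁻¹ * a.1 * b.1, a.2) :: suf)) :=
        Subgroup.subset_closure (mem_letters (x := (b.1⁻¹ * a.1 * b.1, a.2)) (by simp))
      rcases hx with hx | rfl | rfl | hx
      · exact Subgroup.subset_closure (mem_letters (by simp [hx]))
      · have key := Subgroup.mul_mem _ (Subgroup.mul_mem _ hb' hc) (Subgroup.inv_mem _ hb')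
        have e' : b.1 * (b.1⁻¹ * x.1 * b.1) * b.1⁻¹ = x.1 := by group
        rw [e'] at key
        exact key
      · exact hb'
      · exact Subgroup.subset_closure (mem_letters (by simp [hx]))

/-- The generated subgroup is a Hurwitz-orbit invariant. -/
theorem closure_letters_eq_of_hurwitz {l l' : List (G × Bool)}
    (h : Relation.ReflTransGen HurwitzStep l l') :
    Subgroup.closure (letters l') = Subgroup.closure (letters l) := by
  induction h with
  | refl => rfl
  | tail _ hstep ih => rw [hstep.closure_letters_eq, ih]

/-- verbatim copy of `BraidedBranchLocus.GenTransitive` -/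
def GenTransitive {m : ℕ} (T : Set (Equiv.Perm (Fin m))) : Prop :=
  ∀ i j : Fin m, ∃ g ∈ Subgroup.closure T, g i = j

/-- Joint transitivity of the letters is a Hurwitz-orbit invariant. -/
theorem genTransitive_letters_iff_of_hurwitz {m : ℕ} {l l' : List (Equiv.Perm (Fin m) × Bool)}
    (h : Relation.ReflTransGen HurwitzStep l l') :
    GenTransitive (letters l) ↔ GenTransitive (letters l') := by
  simp only [GenTransitive, closure_letters_eq_of_hurwitz h]

/-- All letters are transpositions (the first hypothesis of `HurwitzTransitivity`). -/
def AllTranspositions {m : ℕ} (l : List (Equiv.Perm (Fin m) × Bool)) : Prop :=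
  ∀ x ∈ l, ∃ a b : Fin m, a ≠ b ∧ x.1 = Equiv.swap a b

theorem conj_swap_eq {m : ℕ} (g : Equiv.Perm (Fin m)) (a b : Fin m) :
    g * Equiv.swap a b * g⁻¹ = Equiv.swap (g a) (g b) :=
  (Equiv.swap_apply_apply g a b).symm

/-- Hurwitz moves preserve "all letters are transpositions" (conjugates of transpositions are
transpositions). -/
theorem HurwitzStep.allTranspositions {m : ℕ} {l l' : List (Equiv.Perm (Fin m) × Bool)}
    (h : HurwitzStep l l') (hl : AllTranspositions l) : AllTranspositions l' := by
  obtain ⟨pre, suf, a, b, rfl, h⟩ := h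
  obtain ⟨ua, va, hne_a, ha⟩ := hl a (by simp)
  obtain ⟨ub, vb, hne_b, hb⟩ := hl b (by simp)
  intro x hx
  rcases h with rfl | rfl
  · simp only [List.mem_append, List.mem_cons] at hx
    rcases hx with hx | rfl | rfl | hx
    · exact hl x (by simp [hx])
    · exact ⟨a.1 ub, a.1 vb, fun e => hne_b (a.1.injective e), by rw [hb, conj_swap_eq]⟩
    · exact ⟨ua, va, hne_a, ha⟩
    · exact hl x (by simp [hx])
  · simp only [List.mem_append, List.mem_cons] at hx
    rcases hx with hx | rfl | rfl | hx
    · exact hl x (by simp [hx])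
    · exact ⟨ub, vb, hne_b, hb⟩
    · refine ⟨b.1⁻¹ ua, b.1⁻¹ va, fun e => hne_a (b.1⁻¹.injective e), ?_⟩
      rw [ha, ← conj_swap_eq, inv_inv]
    · exact hl x (by simp [hx])

theorem allTranspositions_of_hurwitz {m : ℕ} {l l' : List (Equiv.Perm (Fin m) × Bool)}
    (h : Relation.ReflTransGen HurwitzStep l l') (hl : AllTranspositions l) : AllTranspositions l' := by
  induction h with
  | refl => exact hl
  | tail _ hstep ih => exact hstep.allTranspositions ih

/-- verbatim copy of `BraidedBranchLocus.HurwitzTransitivity` (the statement of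
`stub_hurwitzTransitive`). -/
def HurwitzTransitivity : Prop :=
  ∀ (m : ℕ) (l : List (Equiv.Perm (Fin m) × Bool)),
    (∀ x ∈ l, ∃ a b : Fin m, a ≠ b ∧ x.1 = Equiv.swap a b) →
    GenTransitive {g | ∃ x ∈ l, x.1 = g} →
    m ≤ (l.filter (fun x => x.2)).length + 1 →
    ∃ l', Relation.ReflTransGen HurwitzStep l l' ∧
      GenTransitive {g | ∃ x ∈ l', x.2 = true ∧ x.1 = g}

/-- The SORTED case of `HurwitzTransitivity`: lists `P ++ N` with `P` positive, `N` negative. -/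
def HurwitzTransitivitySorted : Prop :=
  ∀ (m : ℕ) (P N : List (Equiv.Perm (Fin m) × Bool)),
    AllTranspositions (P ++ N) → (∀ x ∈ P, x.2 = true) → (∀ x ∈ N, x.2 = false) →
    GenTransitive (letters (P ++ N)) → m ≤ P.length + 1 →
    ∃ l', Relation.ReflTransGen HurwitzStep (P ++ N) l' ∧
      GenTransitive {g | ∃ x ∈ l', x.2 = true ∧ x.1 = g}

/-- **WLOG sorted**: `stub_hurwitzTransitive` reduces to lists `P ++ N` (positive letters first,
UNCHANGED; negative letters after), keeping all three hypotheses. -/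
theorem hurwitzTransitivity_of_sorted (hS : HurwitzTransitivitySorted) : HurwitzTransitivity := by
  intro m l hl htrans hcount
  obtain ⟨N, hN, -, hsort⟩ := exists_sorted l
  have hl' : AllTranspositions (l.filter (fun x => x.2) ++ N) := allTranspositions_of_hurwitz hsort hl
  have htrans' : GenTransitive (letters (l.filter (fun x => x.2) ++ N)) :=
    (genTransitive_letters_iff_of_hurwitz hsort).1 htrans
  obtain ⟨l', h1, h2⟩ := hS m (l.filter fun x => x.2) N hl' (fun x hx => (List.mem_filter.1 hx).2)
    hN htrans' hcount
  exact ⟨l', hsort.trans h1, h2⟩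

end Targets

/-! ## §15 (gen 3) CONTACT TWISTED DOUBLES `W₁ ∪_ψ W₂` (ψ a diffeomorphism of the boundaries
carrying the induced plane field of `J₁` to that of `J₂`; both halves ℚ-acyclic compact Stein)
satisfy the ∃-body — the constructive direction of the thesis' dictionary, generalising §13 -/

section TwistedDoubles

open Literature.Topology.FourManifolds
open Summit.SmoothPoincare4.SmoothPoincare4.Theorems.ContractibleTwistedDoubleStandard.Negative

variable {W₁ : Type} [TopologicalSpace W₁] [ChartedSpace (EuclideanHalfSpace 4) W₁]
  [IsManifold (𝓡∂ 4) ∞ W₁] [CompactSpace W₁]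
  {W₂ : Type} [TopologicalSpace W₂] [ChartedSpace (EuclideanHalfSpace 4) W₂]
  [IsManifold (𝓡∂ 4) ∞ W₂] [CompactSpace W₂]
  {P : Type} [TopologicalSpace P] [ChartedSpace 𝔼4 P]

/-- `dι` maps the induced boundary plane ONTO the complex tangencies (`ξ ≤ T∂W = range dι`,
(A2) of the sibling file); the induced plane field on the abstract boundary is the Literature def
`Literature.Geometry.Symplectic.boundaryPlaneField S.J b` (`PlanarContactBoundary.lean`: pull-back
of `contactPlane S.J` along `d(b.incl)`). [folklore] -/
theorem map_mfderiv_incl_boundaryPlaneField (b : BoundaryData (𝓡∂ 4) W₁ (𝓡 3)) (S : SteinStructure W₁)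
    (z : b.carrier) :
    Submodule.map (mfderiv (𝓡 3) (𝓡∂ 4) b.incl z).toLinearMap (boundaryPlaneField S.J b z) =
      contactPlane S.J (b.incl z) := by
  apply Submodule.map_comap_eq_self
  intro v hv
  obtain ⟨u, hu⟩ := exists_mfderiv_incl_eq b z (contactPlane_le_boundaryTangentSpace S.J _ hv)
  exact ⟨u, hu⟩

/-- **A gluing `W₁ ∪_ψ W₂` of two compact Stein domains along a diffeomorphism `ψ : ∂W₁ ≅ ∂W₂`
carrying the induced plane field of `J₁` to that of `J₂` (a contactomorphism of the unoriented,
un-co-oriented complex tangencies) is a Stein bisection along a common contact seam** — the six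
point-set / contact hypotheses of the crux for `(P; W₁, W₂; J₁, J₂; jA, jB)`.  The contact matching:
`d jA (ξ₁) = d jA (dι₁ ξ₁') = d(jA ∘ ι₁)(ξ₁') = d(jB ∘ ι₂ ∘ ψ)(ξ₁') = d jB (d(ι₂ ∘ ψ) ξ₁') = d jB (ξ₂)`.
[folklore] -/
theorem steinBisection_of_twistedGlue (b₁ : BoundaryData (𝓡∂ 4) W₁ (𝓡 3))
    (b₂ : BoundaryData (𝓡∂ 4) W₂ (𝓡 3)) (S₁ : SteinStructure W₁) (S₂ : SteinStructure W₂)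
    (ψ : b₁.carrier ≃ₘ⟮𝓡 3, 𝓡 3⟯ b₂.carrier)
    (hψ : ∀ z, Submodule.map (mfderiv (𝓡 3) (𝓡∂ 4) (b₂.incl ∘ ψ) z).toLinearMap (boundaryPlaneField S₁.J b₁ z) =
      contactPlane S₂.J (b₂.incl (ψ z)))
    {jA : W₁ → P} {jB : W₂ → P}
    (hA : Manifold.IsSmoothEmbedding (𝓡∂ 4) (𝓡 4) ∞ jA)
    (hB : Manifold.IsSmoothEmbedding (𝓡∂ 4) (𝓡 4) ∞ jB) (hU : range jA ∪ range jB = univ)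
    (hR : ∀ a a', jA a = jB a' ↔ ∃ z, a = b₁.incl z ∧ a' = b₂.incl (ψ z)) :
    Manifold.IsSmoothEmbedding (𝓡∂ 4) (𝓡 4) ∞ jA ∧ Manifold.IsSmoothEmbedding (𝓡∂ 4) (𝓡 4) ∞ jB ∧
      range jA ∪ range jB = univ ∧ range jA ∩ range jB = jA '' (𝓡∂ 4).boundary W₁ ∧
      range jA ∩ range jB = jB '' (𝓡∂ 4).boundary W₂ ∧
      (∀ w₁ w₂, jA w₁ = jB w₂ →
        Submodule.map (mfderiv (𝓡∂ 4) (𝓡 4) jA w₁).toLinearMap (contactPlane S₁.J w₁) =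
          Submodule.map (mfderiv (𝓡∂ 4) (𝓡 4) jB w₂).toLinearMap (contactPlane S₂.J w₂)) := by
  have hcomp : jA ∘ b₁.incl = jB ∘ (b₂.incl ∘ ψ) := funext fun z => (hR _ _).2 ⟨z, rfl, rfl⟩
  refine ⟨hA, hB, hU, ?_, ?_, ?_⟩
  · ext p
    constructor
    · rintro ⟨⟨a, rfl⟩, ⟨a', ha'⟩⟩
      obtain ⟨z, rfl, -⟩ := (hR a a').1 ha'.symm
      exact ⟨b₁.incl z, b₁.incl_mem_boundary z, rfl⟩
    · rintro ⟨a, ha, rfl⟩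
      rw [← b₁.range_incl] at ha
      obtain ⟨z, rfl⟩ := ha
      exact ⟨mem_range_self _, ⟨b₂.incl (ψ z), ((hR _ _).2 ⟨z, rfl, rfl⟩).symm⟩⟩
  · ext p
    constructor
    · rintro ⟨⟨a, ha⟩, ⟨a', rfl⟩⟩
      obtain ⟨z, -, rfl⟩ := (hR a a').1 ha
      exact ⟨b₂.incl (ψ z), b₂.incl_mem_boundary _, rfl⟩
    · rintro ⟨a, ha, rfl⟩
      rw [← b₂.range_incl] at ha
      obtain ⟨z', rfl⟩ := ha
      obtain ⟨z, rfl⟩ := ψ.surjective z'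
      exact ⟨⟨b₁.incl z, (hR _ _).2 ⟨z, rfl, rfl⟩⟩, mem_range_self _⟩
  · intro w₁ w₂ hw
    obtain ⟨z, rfl, rfl⟩ := (hR w₁ w₂).1 hw
    have hι₁ : MDifferentiableAt (𝓡 3) (𝓡∂ 4) b₁.incl z :=
      b₁.isSmoothEmbedding.contMDiff.mdifferentiableAt (by simp)
    have hι₂ψ : MDifferentiableAt (𝓡 3) (𝓡∂ 4) (b₂.incl ∘ ψ) z :=
      ((b₂.isSmoothEmbedding.contMDiff.comp ψ.contMDiff).mdifferentiableAt (by simp))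
    have hjA : MDifferentiableAt (𝓡∂ 4) (𝓡 4) jA (b₁.incl z) := hA.contMDiff.mdifferentiableAt (by simp)
    have hjB : MDifferentiableAt (𝓡∂ 4) (𝓡 4) jB ((b₂.incl ∘ ψ) z) :=
      hB.contMDiff.mdifferentiableAt (by simp)
    have eA := mfderiv_comp z hjA hι₁
    have eB := mfderiv_comp z hjB hι₂ψ
    have hAB : mfderiv (𝓡 3) (𝓡 4) (jA ∘ b₁.incl) z = mfderiv (𝓡 3) (𝓡 4) (jB ∘ (b₂.incl ∘ ψ)) z := by
      rw [hcomp]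
    have step1 : Submodule.map (mfderiv (𝓡∂ 4) (𝓡 4) jA (b₁.incl z)).toLinearMap (contactPlane S₁.J (b₁.incl z))
        = Submodule.map (mfderiv (𝓡∂ 4) (𝓡 4) jA (b₁.incl z)).toLinearMap
            (Submodule.map (mfderiv (𝓡 3) (𝓡∂ 4) b₁.incl z).toLinearMap (boundaryPlaneField S₁.J b₁ z)) := by
      rw [map_mfderiv_incl_boundaryPlaneField]
    have step2 : Submodule.map (mfderiv (𝓡∂ 4) (𝓡 4) jA (b₁.incl z)).toLinearMap
            (Submodule.map (mfderiv (𝓡 3) (𝓡∂ 4) b₁.incl z).toLinearMap (boundaryPlaneField S₁.J b₁ z))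
        = Submodule.map (mfderiv (𝓡 3) (𝓡 4) (jA ∘ b₁.incl) z).toLinearMap (boundaryPlaneField S₁.J b₁ z) := by
      rw [← Submodule.map_comp]
      exact (congrArg (fun T : TangentSpace (𝓡 3) z →L[ℝ] TangentSpace (𝓡 4) (jA (b₁.incl z)) =>
        Submodule.map T.toLinearMap (boundaryPlaneField S₁.J b₁ z)) eA).symm
    have step3 : Submodule.map (mfderiv (𝓡 3) (𝓡 4) (jA ∘ b₁.incl) z).toLinearMap (boundaryPlaneField S₁.J b₁ z)
        = Submodule.map (mfderiv (𝓡 3) (𝓡 4) (jB ∘ (b₂.incl ∘ ψ)) z).toLinearMap (boundaryPlaneField S₁.J b₁ z) :=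
      congrArg (fun T : TangentSpace (𝓡 3) z →L[ℝ] 𝔼4 =>
        Submodule.map T.toLinearMap (boundaryPlaneField S₁.J b₁ z)) hAB
    have step4 : Submodule.map (mfderiv (𝓡 3) (𝓡 4) (jB ∘ (b₂.incl ∘ ψ)) z).toLinearMap (boundaryPlaneField S₁.J b₁ z)
        = Submodule.map (mfderiv (𝓡∂ 4) (𝓡 4) jB ((b₂.incl ∘ ψ) z)).toLinearMap
            (Submodule.map (mfderiv (𝓡 3) (𝓡∂ 4) (b₂.incl ∘ ψ) z).toLinearMap (boundaryPlaneField S₁.J b₁ z)) := by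
      rw [← Submodule.map_comp]
      exact congrArg (fun T : TangentSpace (𝓡 3) z →L[ℝ] TangentSpace (𝓡 4) (jB ((b₂.incl ∘ ψ) z)) =>
        Submodule.map T.toLinearMap (boundaryPlaneField S₁.J b₁ z)) eB
    have step5 : Submodule.map (mfderiv (𝓡∂ 4) (𝓡 4) jB ((b₂.incl ∘ ψ) z)).toLinearMap
            (Submodule.map (mfderiv (𝓡 3) (𝓡∂ 4) (b₂.incl ∘ ψ) z).toLinearMap (boundaryPlaneField S₁.J b₁ z))
        = Submodule.map (mfderiv (𝓡∂ 4) (𝓡 4) jB (b₂.incl (ψ z))).toLinearMap (contactPlane S₂.J (b₂.incl (ψ z))) := by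
      rw [hψ z]; rfl
    exact step1.trans (step2.trans (step3.trans (step4.trans step5)))

/-- **Every contact twisted double is a witness of the crux's ∃-body minus acyclicity.** [folklore] -/
def Witness.ofTwistedGlue (b₁ : BoundaryData (𝓡∂ 4) W₁ (𝓡 3))
    (b₂ : BoundaryData (𝓡∂ 4) W₂ (𝓡 3)) (S₁ : SteinStructure W₁) (S₂ : SteinStructure W₂)
    (ψ : b₁.carrier ≃ₘ⟮𝓡 3, 𝓡 3⟯ b₂.carrier)
    (hψ : ∀ z, Submodule.map (mfderiv (𝓡 3) (𝓡∂ 4) (b₂.incl ∘ ψ) z).toLinearMap (boundaryPlaneField S₁.J b₁ z) =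
      contactPlane S₂.J (b₂.incl (ψ z)))
    (h : IsBoundaryGluing b₁ b₂ ψ (𝓡 4) P) : Witness P :=
  let jA := h.choose
  let jB := h.choose_spec.choose
  have H := steinBisection_of_twistedGlue b₁ b₂ S₁ S₂ ψ hψ h.choose_spec.choose_spec.1
    h.choose_spec.choose_spec.2.1 h.choose_spec.choose_spec.2.2.1 h.choose_spec.choose_spec.2.2.2
  { W₁ := W₁, W₂ := W₂, J₁ := S₁, J₂ := S₂, e₁ := jA, e₂ := jB,
    emb₁ := H.1, emb₂ := H.2.1, cover := H.2.2.1, inter₁ := H.2.2.2.1, inter₂ := H.2.2.2.2.1,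
    contact := H.2.2.2.2.2 }

/-- **The ∃-body HOLDS on every contact twisted double `W₁ ∪_ψ W₂` of two ℚ-acyclic compact Stein
domains** (`ψ : ∂W₁ ≅ ∂W₂` a diffeomorphism carrying the induced plane field of `J₁` to that of
`J₂`).  This is the constructive direction of the thesis' dictionary "acyclic Stein bisection =
contact twisted double of ℚ-acyclic Stein fillings of one contact ℚHS³": every such regluing —
in particular every cork twist `C ∪_τ C̄` by a contactomorphism `τ` of the Stein-induced structure
(Gompf arXiv:1603.05090 Q2.2 sector of the rigidity crux) — satisfies `AcyclicBisectionExists` at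
its own total space, whatever its diffeomorphism type. [folklore] -/
theorem hasAcyclicSteinBisection_of_twistedGlue (b₁ : BoundaryData (𝓡∂ 4) W₁ (𝓡 3))
    (b₂ : BoundaryData (𝓡∂ 4) W₂ (𝓡 3)) (S₁ : SteinStructure W₁) (S₂ : SteinStructure W₂)
    (ψ : b₁.carrier ≃ₘ⟮𝓡 3, 𝓡 3⟯ b₂.carrier)
    (hψ : ∀ z, Submodule.map (mfderiv (𝓡 3) (𝓡∂ 4) (b₂.incl ∘ ψ) z).toLinearMap (boundaryPlaneField S₁.J b₁ z) =
      contactPlane S₂.J (b₂.incl (ψ z)))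
    (hW₁ : ∀ k, 0 < k → IsZero (singularHomology ℚ ℚ W₁ k))
    (hW₂ : ∀ k, 0 < k → IsZero (singularHomology ℚ ℚ W₂ k))
    (h : IsBoundaryGluing b₁ b₂ ψ (𝓡 4) P) : HasAcyclicSteinBisection P :=
  ⟨Witness.ofTwistedGlue b₁ b₂ S₁ S₂ ψ hψ h, fun k hk => ⟨hW₁ k hk, hW₂ k hk⟩⟩

/-- **Existence form**: the contact twisted double `W₁ ∪_ψ W₂` exists as a closed smooth
4-manifold (tree `exists_isBoundaryGluing_holds`) and carries a ℚ-acyclic Stein bisection along a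
common contact seam. [folklore] -/
theorem exists_twistedGlue_hasAcyclicSteinBisection [T2Space W₁] [T2Space W₂]
    (b₁ : BoundaryData (𝓡∂ 4) W₁ (𝓡 3)) (b₂ : BoundaryData (𝓡∂ 4) W₂ (𝓡 3))
    (S₁ : SteinStructure W₁) (S₂ : SteinStructure W₂) (ψ : b₁.carrier ≃ₘ⟮𝓡 3, 𝓡 3⟯ b₂.carrier)
    (hψ : ∀ z, Submodule.map (mfderiv (𝓡 3) (𝓡∂ 4) (b₂.incl ∘ ψ) z).toLinearMap (boundaryPlaneField S₁.J b₁ z) =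
      contactPlane S₂.J (b₂.incl (ψ z)))
    (hW₁ : ∀ k, 0 < k → IsZero (singularHomology ℚ ℚ W₁ k))
    (hW₂ : ∀ k, 0 < k → IsZero (singularHomology ℚ ℚ W₂ k)) :
    ∃ (P : Type) (_ : TopologicalSpace P) (_ : T2Space P) (_ : SecondCountableTopology P)
      (_ : CompactSpace P) (_ : ChartedSpace 𝔼4 P) (_ : IsManifold (𝓡 4) ∞ P),
      IsBoundaryGluing b₁ b₂ ψ (𝓡 4) P ∧ HasAcyclicSteinBisection P := by
  obtain ⟨P, _, _, _, _, _, _, hP⟩ := exists_isBoundaryGluing_holds (bM := b₁) (bN := b₂) ψ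
  exact ⟨P, ‹_›, ‹_›, ‹_›, ‹_›, ‹_›, ‹_›, hP,
    hasAcyclicSteinBisection_of_twistedGlue b₁ b₂ S₁ S₂ ψ hψ hW₁ hW₂ hP⟩

end TwistedDoubles

end Summit.SmoothPoincare4.SmoothPoincare4.Cruxes.AcyclicBisectionExists.Disproof
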